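import Literature.Barriers.CriticalPhenomena.SAPAnisotropicNotDFinite242Structure
import HarnessLib

/-!
# Rechnitzer's Lemma 23 discharged: gluing and cutting 2-4-2 words along the duplicated row

Proofs companion (last part) of
`Literature/Barriers/CriticalPhenomena/SAPAnisotropicNotDFinite242Hadamard.lean` (A. Rechnitzer,
*Haruspicy 2: The anisotropic generating function of self-avoiding polygons is not D-finite*,
J. Combin. Theory Ser. A 113 (2006) 520–546, arXiv:math/0406450v2, §3.3). Its named fact
`Rechnitzer2006_lem23` is **Lemma 23** (eq. (28),
`f(s;x,y) = ysx/(1-sx) + Σ_{n ≥ 1} f_n(x,y) T_n(s;x,y)/(y xⁿ)`) read as the identity of the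
coefficients of `y^{3k+1} s^w x^m`, `k ≥ 1`, in the rooted-walk model:
`p^{242}_{k+1}(m,w) = Σ_{t=1}^{m} Σ_{i+j=m} p^{242}_k(i,t) · bb(j+t,t,w)`. The printed proof is
the picture of Figures 9–10: "[a] 2-4-2 polygon is either a rectangle of unit height … or may
be constructed by combining a 2-4-2 polygon, whose last row is of length `n` … with a 2-4-2
[building block] whose top row is of length `n` …; when the building block is joined to the
polygon and the duplicated row is 'squashed', the total vertical half-perimeter is reduced by
`1` (two vertical bonds are removed) and the total horizontal half-perimeter is reduced by the
length of the join (two horizontal bonds are removed for each cell in the join)."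
This file PROVES it (`Rechnitzer2006_lem23_holds`), on canonical words
(`SAPAnisotropicNotDFinite242Words`: `p^{242}_k(m,w) = #c242Words k m w`,
`bb(M,t,w) = #bbWords M t w`, the `2N`-to-one correspondence refined by the 2-4-2 statistics;
`SAPAnisotropicNotDFinite242Structure`: a canonical 2-4-2 word is `E^w N α₁ N β S α₂ S`, the
duplicated row going up in column `b` at time `p` and coming down in column `a < b` at time `q`).
Both gluing and cutting are SPLICES — replacing a stretch of a word by another word with the
same displacement:

* `splice X P R M = X.take P ++ M ++ X.drop R`, its vertices (`vtx_splice_left/mid/right`),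
  letter count (`hcount_splice`) and the round trip `splice_splice`; `upperWord t β = E^t N β S`,
  the word of the polygon above the duplicated row;
* `SpliceHyp` / `UpperHyp` — the height-separation hypotheses under which a splice, resp. an
  upper word, is again a canonical SAP word (`SpliceHyp.isCanon`, `UpperHyp.isCanon`), with its
  vertical bonds row by row (`SpliceHyp.rowVerticalBonds_eq`, `UpperHyp.rowVerticalBonds_eq`);
  `length_eq_hcount_add_sum` — the vertical letters are the vertical bonds, row by row (the
  perimeter bookkeeping quoted above);
* `firstTop`, `body`, `glue W' Q` — gluing the building block `Q` under the polygon `W'`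
  (replace the top run `W^t` of `Q` by the body of `W'`), and the data of the pieces
  (`IsCanon.eq_upperWord`: `W' = upperWord t (body W')`; `upper_data`, `block_data`);
* `BandSplice` — the common shape of gluing (`X` = a block, `M` = a body) and cutting (`X` = a
  polygon, `M = W^t`): the splice is canonical with the same bottom row and band decomposition
  (`isCanon`, `bottomWidth_eq`, `isBand`), its top/highest rows (`topWidth_eq_of_replicate`,
  `yMax_eq`), and exchanging the bodies exchanges their vertical bonds (`rowVerticalBonds_eq`);
* `glue_spec` — gluing `Q ∈ bbWords (j+t) t w` under `W' ∈ c242Words k i t` gives a word of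
  `c242Words (k+1) (i+j) w` from which `W'` and `Q` can be read off (the band decomposition of
  the glued word is unique, `IsBand.unique`); `cut_spec` — every `W ∈ c242Words (k+1) m w` is so
  glued (cut along the duplicated third row, `IsCanon.exists_isBand`, whose orientation lemma
  `a < b` makes the upper piece, read in the induced orientation, canonical again);
* `Rechnitzer2006_lem23_holds` — `Finset.card_bij` with the gluing map.

So `Rechnitzer2006_lem25_rec` (`Rechnitzer2006_lem25_rec_of_lem23_eq29`) now rests on
`Rechnitzer2006_eq29` alone (the partial fraction expansion (29)/(31) of the building-block
generating function of Lemma 21). [folklore] for the word combinatorics; the decomposition is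
that of [Rechnitzer2006Haruspicy2], Lemma 23 and Figures 9–10.

## References

* A. Rechnitzer, *Haruspicy 2*, op. cit.: §3.3, Lemma 21, Lemma 23, eq. (28), Figures 9–10.
  [Rechnitzer2006Haruspicy2]
* N. Madras, G. Slade, *The Self-Avoiding Walk*, Birkhäuser 1993: Definition 3.2.1,
  eq. (3.2.1). [MadrasSlade1993]
-/

noncomputable section

open Finset Literature.Probability.LatticeModels Literature.Probability.Percolation
open scoped BigOperators

namespace Literature.Barriers.CriticalPhenomena

namespace Haruspicy

open Edwards2D

/-! ### Vertices of concatenations -/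

section Append

variable (A B C : List (Fin 4))

/-- Vertices of a three-fold concatenation, first part. [folklore] -/
theorem vtx_append3_left {i : ℕ} (hi : i ≤ A.length) : vtx (A ++ B ++ C) i = vtx A i := by
  rw [List.append_assoc, vtx_append_left _ _ hi]

/-- Vertices of a three-fold concatenation, middle part. [folklore] -/
theorem vtx_append3_mid {j : ℕ} (hj : j ≤ B.length) :
    vtx (A ++ B ++ C) (A.length + j) = (A.map stepVec).sum + vtx B j := by
  rw [List.append_assoc, vtx_append_add, vtx_append_left _ _ hj]

/-- Vertices of a three-fold concatenation, last part. [folklore] -/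
theorem vtx_append3_right (j : ℕ) :
    vtx (A ++ B ++ C) (A.length + B.length + j) = (A.map stepVec).sum + (B.map stepVec).sum + vtx C j := by
  rw [show A.length + B.length + j = (A ++ B).length + j by rw [List.length_append], vtx_append_add,
    List.map_append, List.sum_append]

/-- The steps of a prefix sum to the vertex. [folklore] -/
theorem sum_map_take (X : List (Fin 4)) (P : ℕ) : ((X.take P).map stepVec).sum = vtx X P := rfl

end Append

/-! ### Splicing a word: replacing a stretch by another word -/

section Splice

/-- **Splicing.** Replace the stretch of `X` between the times `P ≤ R` by the word `M` (read from
`vtx X P`): `X.take P ++ M ++ X.drop R`. Gluing a building block under a polygon, and cutting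
it off again, are splices. [cite: Rechnitzer2006Haruspicy2, Lemma 23 (Fig. 10)] -/
def splice (X : List (Fin 4)) (P R : ℕ) (M : List (Fin 4)) : List (Fin 4) :=
  X.take P ++ M ++ X.drop R

variable {X M : List (Fin 4)} {P R : ℕ}

/-- Length of a splice. [folklore] -/
theorem length_splice (hP : P ≤ R) (hR : R ≤ X.length) :
    (splice X P R M).length = P + M.length + (X.length - R) := by
  simp [splice, min_eq_left (hP.trans hR)]
  omega

/-- Vertices of a splice, first part. [folklore] -/
theorem vtx_splice_left (hP : P ≤ X.length) {i : ℕ} (hi : i ≤ P) :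
    vtx (splice X P R M) i = vtx X i := by
  rw [splice, vtx_append3_left _ _ _ (by simp [min_eq_left hP]; exact hi), vtx_take _ hi]

/-- Vertices of a splice, middle part. [folklore] -/
theorem vtx_splice_mid (hP : P ≤ X.length) {j : ℕ} (hj : j ≤ M.length) :
    vtx (splice X P R M) (P + j) = vtx X P + vtx M j := by
  have hlen : (X.take P).length = P := by simp [min_eq_left hP]
  rw [splice, show P + j = (X.take P).length + j by rw [hlen], vtx_append3_mid _ _ _ hj,
    sum_map_take]

/-- Vertices of a splice, last part (the spliced word has the right displacement). [folklore] -/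
theorem vtx_splice_right (hP : P ≤ R) (hR : R ≤ X.length)
    (hsum : (M.map stepVec).sum = vtx X R - vtx X P) (j : ℕ) :
    vtx (splice X P R M) (P + M.length + j) = vtx X (R + j) := by
  have hlen : (X.take P).length = P := by simp [min_eq_left (hP.trans hR)]
  rw [splice, show P + M.length + j = (X.take P).length + M.length + j by rw [hlen],
    vtx_append3_right, sum_map_take, hsum, vtx_drop]
  abel

/-- A splice with the right displacement has the same total displacement. [folklore] -/
theorem sum_map_splice (hP : P ≤ R) (hR : R ≤ X.length)
    (hsum : (M.map stepVec).sum = vtx X R - vtx X P) :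
    ((splice X P R M).map stepVec).sum = (X.map stepVec).sum := by
  rw [← vtx_length, length_splice hP hR, vtx_splice_right hP hR hsum, Nat.add_sub_cancel' hR,
    vtx_length]

/-- The three parts of a word. [folklore] -/
theorem take_append_take_append_drop (X : List (Fin 4)) (hP : P ≤ R) :
    X.take P ++ (X.drop P).take (R - P) ++ X.drop R = X := by
  conv_rhs => rw [← List.take_append_drop R X, show R = P + (R - P) by omega, List.take_add,
    show P + (R - P) = R by omega]

/-- Horizontal letters of a splice. [folklore] -/
theorem hcount_splice (hP : P ≤ R) :
    hcount (splice X P R M) + hcount ((X.drop P).take (R - P)) = hcount X + hcount M := by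
  conv_rhs => rw [← take_append_take_append_drop X hP]
  simp only [splice, hcount_append]
  ring

/-- The first part of a splice. [folklore] -/
theorem take_splice (hP : P ≤ X.length) : (splice X P R M).take P = X.take P := by
  rw [splice, List.append_assoc, List.take_left' (by simp [min_eq_left hP])]

/-- The middle part of a splice. [folklore] -/
theorem take_drop_splice (hP : P ≤ X.length) :
    ((splice X P R M).drop P).take M.length = M := by
  rw [splice, List.append_assoc, List.drop_left' (by simp [min_eq_left hP]), List.take_left' rfl]

/-- The last part of a splice. [folklore] -/
theorem drop_splice (hP : P ≤ X.length) : (splice X P R M).drop (P + M.length) = X.drop R := by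
  rw [splice, List.drop_left']
  simp [min_eq_left hP]

/-- **Splicing back.** Cutting out what was spliced in and re-inserting the original stretch
gives back the original word. [folklore] -/
theorem splice_splice (hP : P ≤ R) (hR : R ≤ X.length) :
    splice (splice X P R M) P (P + M.length) ((X.drop P).take (R - P)) = X := by
  conv_rhs => rw [← take_append_take_append_drop X hP]
  rw [splice, take_splice (hP.trans hR), drop_splice (hP.trans hR)]

/-- The first letter of a splice after a positive time. [folklore] -/
theorem head?_splice (hP : 1 ≤ P) (hPX : P ≤ X.length) : (splice X P R M).head? = X.head? := by
  obtain ⟨a, X', rfl⟩ : ∃ a X', X = a :: X' := by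
    cases X with
    | nil => simp at hPX; omega
    | cons a X' => exact ⟨a, X', rfl⟩
  obtain ⟨P', rfl⟩ : ∃ P', P = P' + 1 := ⟨P - 1, by omega⟩
  simp [splice]

end Splice

/-! ### The word of the upper polygon: `E^t N β S` -/

section Upper

/-- The word `E^t N β S`: bottom row of width `t`, up, the body `β`, down — the canonical word
of the polygon above the duplicated row, whose bottom row is that row.
[cite: Rechnitzer2006Haruspicy2, Lemma 23 (Fig. 10)] -/
def upperWord (t : ℕ) (β : List (Fin 4)) : List (Fin 4) :=
  List.replicate t 0 ++ [2] ++ β ++ [3]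

variable (t : ℕ) (β : List (Fin 4))

/-- `upperWord` as a three-fold concatenation. [folklore] -/
theorem upperWord_eq : upperWord t β = (List.replicate t 0 ++ [2]) ++ β ++ [3] := rfl

/-- Length of `upperWord`. [folklore] -/
@[simp] theorem length_upperWord : (upperWord t β).length = t + 2 + β.length := by
  simp [upperWord]; ring

/-- The steps of `E^t N` sum to `(t, 1)`. [folklore] -/
theorem sum_prefix_upper :
    ((List.replicate t (0 : Fin 4) ++ [2]).map stepVec).sum = ![(t : ℤ), 1] := by
  rw [List.map_append, List.sum_append, sum_replicate_stepVec]
  ext i; fin_cases i <;> simp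

/-- Vertices of `upperWord` on the bottom row: `(i, 0)`. [folklore] -/
theorem vtx_upperWord_bottom {i : ℕ} (hi : i ≤ t) :
    vtx (upperWord t β) i 0 = i ∧ vtx (upperWord t β) i 1 = 0 := by
  rw [upperWord_eq, vtx_append3_left _ _ _ (by simp; omega), vtx_append_left _ _ (by simpa),
    vtx_replicate t 0 hi]
  simp

/-- Vertices of `upperWord` along the body: `(t, 1) + vtx β j`. [folklore] -/
theorem vtx_upperWord_body {j : ℕ} (hj : j ≤ β.length) :
    vtx (upperWord t β) (t + 1 + j) = ![(t : ℤ), 1] + vtx β j := by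
  rw [upperWord_eq, show t + 1 + j = (List.replicate t (0 : Fin 4) ++ [2]).length + j by simp,
    vtx_append3_mid _ _ _ hj, sum_prefix_upper]

/-- The last vertex of `upperWord`. [folklore] -/
theorem vtx_upperWord_length :
    vtx (upperWord t β) (t + 2 + β.length) = ![(t : ℤ), 1] + (β.map stepVec).sum + ![0, -1] := by
  rw [upperWord_eq, show t + 2 + β.length =
      (List.replicate t (0 : Fin 4) ++ [2]).length + β.length + 1 by simp; ring,
    vtx_append3_right, sum_prefix_upper]
  congr 1
  ext i; fin_cases i <;> simp [vtx]

/-- Horizontal letters of `upperWord`. [folklore] -/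
theorem hcount_upperWord : hcount (upperWord t β) = t + hcount β := by
  simp [upperWord, hcount, List.countP_replicate]

/-- The first letter of `upperWord` is `E` (for `t ≥ 1`). [folklore] -/
theorem head?_upperWord (ht : 1 ≤ t) : (upperWord t β).head? = some 0 := by
  obtain ⟨t', rfl⟩ : ∃ t', t = t' + 1 := ⟨t - 1, by omega⟩
  simp [upperWord, List.replicate_succ]

/-- The body of `upperWord`. [folklore] -/
theorem take_drop_upperWord : ((upperWord t β).drop (t + 1)).take β.length = β := by
  rw [upperWord_eq, List.append_assoc, List.drop_left' (by simp), List.take_left' rfl]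

end Upper
/-! ### Splitting counts over a range -/

section RangeSplit

/-- Splitting a filtered count over `range (a + b)`. [folklore] -/
theorem card_filter_range_add {p : ℕ → Prop} {_ : DecidablePred p} (a b : ℕ) :
    ((Finset.range (a + b)).filter p).card =
      ((Finset.range a).filter p).card + ((Finset.range b).filter fun j => p (a + j)).card := by
  classical
  have hdisj : Disjoint ((Finset.range a).filter p)
      (((Finset.range b).map (addLeftEmbedding a)).filter p) := by
    rw [Finset.disjoint_left]
    intro x h1 h2
    rw [Finset.mem_filter, Finset.mem_range] at h1
    rw [Finset.mem_filter, Finset.mem_map] at h2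
    obtain ⟨⟨j, -, hj⟩, -⟩ := h2
    simp only [addLeftEmbedding_apply] at hj
    omega
  rw [Finset.range_add, Finset.filter_union, Finset.card_union_of_disjoint hdisj, Finset.filter_map,
    Finset.card_map]
  have : ((Finset.range b).filter (p ∘ ⇑(addLeftEmbedding a))).card =
      ((Finset.range b).filter fun j => p (a + j)).card := card_filter_congr' fun j _ => Iff.rfl
  omega

variable {W : List (Fin 4)}

open Classical in
/-- The vertical bonds of a word in row `r`, split at two times `P ≤ R`. [folklore] -/
theorem rowVerticalBonds_split (W : List (Fin 4)) {P R : ℕ} (hPR : P ≤ R) (hR : R ≤ W.length)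
    (r : ℤ) : rowVerticalBonds (bonds W) r =
      ((Finset.range P).filter fun i => IsCross r (vtx W i 1) (vtx W (i + 1) 1)).card +
      ((Finset.range (R - P)).filter fun j => IsCross r (vtx W (P + j) 1) (vtx W (P + j + 1) 1)).card +
      ((Finset.range (W.length - R)).filter fun j =>
        IsCross r (vtx W (R + j) 1) (vtx W (R + j + 1) 1)).card := by
  rw [rowVerticalBonds_bonds]
  conv_lhs => rw [show W.length = P + (R - P) + (W.length - R) by omega]
  rw [card_filter_range_add, card_filter_range_add]
  congr 1
  refine card_filter_congr' fun j _ => ?_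
  rw [show P + (R - P) + j = R + j by omega]

end RangeSplit

/-! ### The shape of a splice -/

section SpliceShape

variable {X M : List (Fin 4)} {P R : ℕ} {H : ℤ}

/-- The hypotheses of the splice lemmas: the stretch `(P, R]` of `X` is replaced by `M`, which
has the right displacement, stays at heights `≥ H` (read from `vtx X P`) and does not intersect
itself, while the rest of `X` stays strictly below height `H`. [folklore] -/
structure SpliceHyp (X : List (Fin 4)) (P R : ℕ) (M : List (Fin 4)) (H : ℤ) : Prop where
  /-- the splice happens after the root -/
  one_le : 1 ≤ P
  /-- the times are ordered -/
  le : P ≤ R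
  /-- something of `X` remains after the splice -/
  lt : R < X.length
  /-- `M` has the displacement of the replaced stretch -/
  sum_eq : (M.map stepVec).sum = vtx X R - vtx X P
  /-- the rest of `X` is strictly below height `H` -/
  out : ∀ i ≤ X.length, (i < P ∨ R < i) → vtx X i 1 < H
  /-- `M` stays at heights `≥ H` -/
  mid : ∀ j ≤ M.length, H ≤ (vtx X P + vtx M j) 1
  /-- `M` is self-avoiding (endpoints included) -/
  inj : ∀ j j', j ≤ M.length → j' ≤ M.length → vtx M j = vtx M j' → j = j'

namespace SpliceHyp

variable (h : SpliceHyp X P R M H)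
include h

/-- Length of the splice. [folklore] -/
theorem length_eq : (splice X P R M).length = P + M.length + (X.length - R) :=
  length_splice h.le h.lt.le

/-- The three zones of times of a splice, with their vertices and heights. [folklore] -/
theorem zone {i : ℕ} (hi : i ≤ (splice X P R M).length) :
    (i < P ∧ vtx (splice X P R M) i = vtx X i ∧ vtx X i 1 < H) ∨
    (∃ j ≤ M.length, i = P + j ∧ vtx (splice X P R M) i = vtx X P + vtx M j) ∨
    (∃ j, 1 ≤ j ∧ R + j ≤ X.length ∧ i = P + M.length + j ∧
      vtx (splice X P R M) i = vtx X (R + j) ∧ vtx X (R + j) 1 < H) := by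
  rw [h.length_eq] at hi
  have hPX : P ≤ X.length := h.le.trans h.lt.le
  rcases Nat.lt_or_ge i P with h1 | h1
  · exact Or.inl ⟨h1, vtx_splice_left hPX h1.le, h.out i (by omega) (Or.inl h1)⟩
  rcases Nat.lt_or_ge (P + M.length) i with h2 | h2
  · obtain ⟨j, rfl⟩ : ∃ j, i = P + M.length + j := ⟨i - (P + M.length), by omega⟩
    refine Or.inr (Or.inr ⟨j, by omega, by omega, rfl, vtx_splice_right h.le h.lt.le h.sum_eq j,
      h.out _ (by omega) (Or.inr (by omega))⟩)
  · obtain ⟨j, rfl⟩ : ∃ j, i = P + j := ⟨i - P, by omega⟩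
    exact Or.inr (Or.inl ⟨j, by omega, rfl, vtx_splice_mid hPX (by omega)⟩)

/-- **A splice is self-avoiding** (when `X` is): the three zones are separated by the height
`H`, the outer zones are parts of `X`, the middle zone is `M`. [folklore] -/
theorem injOn (hX : Set.InjOn (vtx X) (Set.Iio X.length)) :
    Set.InjOn (vtx (splice X P R M)) (Set.Iio (splice X P R M).length) := by
  intro i hi i' hi' he
  simp only [Set.mem_Iio] at hi hi'
  have hle := h.le
  have hlt := h.lt
  have hz := h.zone hi.le
  have hz' := h.zone hi'.le
  rw [h.length_eq] at hi hi'
  rcases hz with ⟨h1, e1, y1⟩ | ⟨j, hj, rfl, e1⟩ | ⟨j, hj1, hj2, rfl, e1, y1⟩ <;>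
    rcases hz' with ⟨h1', e1', y1'⟩ | ⟨j', hj', hii', e1'⟩ | ⟨j', hj1', hj2', hii', e1', y1'⟩
  · rw [e1, e1'] at he
    exact hX (show i < X.length by omega) (show i' < X.length by omega) he
  · rw [e1, e1'] at he
    have := h.mid j' hj'
    rw [← he] at this
    omega
  · rw [e1, e1'] at he
    have := hX (show i < X.length by omega) (show R + j' < X.length by omega) he
    omega
  · rw [e1, e1'] at he
    have := h.mid j hj
    rw [he] at this
    omega
  · rw [e1, e1'] at he
    have := h.inj j j' hj hj' (add_left_cancel he)
    omega
  · rw [e1, e1'] at he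
    have := h.mid j hj
    rw [he] at this
    omega
  · rw [e1, e1'] at he
    have := hX (show R + j < X.length by omega) (show i' < X.length by omega) he
    omega
  · rw [e1, e1'] at he
    have := h.mid j' hj'
    rw [← he] at this
    omega
  · rw [e1, e1'] at he
    have := hX (show R + j < X.length by omega) (show R + j' < X.length by omega) he
    omega

/-- **A splice is rooted** (when `X` is and `H ≥ 1`). [folklore] -/
theorem isRooted (hX : IsRooted X) (hH : 1 ≤ H) : IsRooted (splice X P R M) := by
  intro i hi
  have hle := h.le
  have hlt := h.lt
  rcases h.zone hi.le with ⟨h1, e1, -⟩ | ⟨j, hj, rfl, e1⟩ | ⟨j, -, hj2, rfl, e1, -⟩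
  · rw [e1]; exact hX i (by omega)
  · rw [e1, key_le_key]
    have := h.mid j hj
    left
    show (0 : Site 2) 1 < _
    simp only [Pi.zero_apply]
    omega
  · rw [e1]
    exact hX _ (by rw [h.length_eq] at hi; omega)

/-- **A splice is a SAP word** (when `X` is). [folklore] -/
theorem isSAP (hX : IsSAP X) (h4 : 4 ≤ P + M.length + (X.length - R)) : IsSAP (splice X P R M) :=
  ⟨by rw [h.length_eq]; exact h4, by rw [sum_map_splice h.le h.lt.le h.sum_eq]; exact hX.2.1,
    h.injOn hX.2.2⟩

/-- **A splice of a canonical word is canonical** (for `H ≥ 1`). [folklore] -/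
theorem isCanon (hX : IsCanon X) (hH : 1 ≤ H) (h4 : 4 ≤ P + M.length + (X.length - R)) :
    IsCanon (splice X P R M) :=
  ⟨h.isSAP hX.1 h4, h.isRooted hX.2.1 hH, by
    rw [head?_splice h.one_le (h.le.trans h.lt.le)]; exact hX.2.2⟩

open Classical in
/-- **The vertical bonds of a splice**, row by row: those of `X` outside the replaced stretch
plus those of `M`. [folklore] -/
theorem rowVerticalBonds_eq (r : ℤ) :
    rowVerticalBonds (bonds (splice X P R M)) r +
      ((Finset.range (R - P)).filter fun j => IsCross r (vtx X (P + j) 1) (vtx X (P + j + 1) 1)).card =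
    rowVerticalBonds (bonds X) r +
      ((Finset.range M.length).filter fun j =>
        IsCross r ((vtx X P + vtx M j) 1) ((vtx X P + vtx M (j + 1)) 1)).card := by
  have hPX : P ≤ X.length := h.le.trans h.lt.le
  have hlen := h.length_eq
  rw [rowVerticalBonds_split X h.le h.lt.le r,
    rowVerticalBonds_split (splice X P R M) (Nat.le_add_right P M.length) (by rw [hlen]; omega) r,
    Nat.add_sub_cancel_left, hlen, Nat.add_sub_cancel_left]
  have e1 : ((Finset.range P).filter fun i =>
      IsCross r (vtx (splice X P R M) i 1) (vtx (splice X P R M) (i + 1) 1)).card =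
      ((Finset.range P).filter fun i => IsCross r (vtx X i 1) (vtx X (i + 1) 1)).card := by
    refine card_filter_congr' fun i hi => ?_
    rw [Finset.mem_range] at hi
    rw [vtx_splice_left hPX hi.le, vtx_splice_left hPX hi]
  have e2 : ((Finset.range M.length).filter fun j =>
      IsCross r (vtx (splice X P R M) (P + j) 1) (vtx (splice X P R M) (P + j + 1) 1)).card =
      ((Finset.range M.length).filter fun j =>
        IsCross r ((vtx X P + vtx M j) 1) ((vtx X P + vtx M (j + 1)) 1)).card := by
    refine card_filter_congr' fun j hj => ?_
    rw [Finset.mem_range] at hj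
    rw [vtx_splice_mid hPX hj.le, add_assoc, vtx_splice_mid hPX hj]
  have e3 : ((Finset.range (X.length - R)).filter fun j =>
      IsCross r (vtx (splice X P R M) (P + M.length + j) 1)
        (vtx (splice X P R M) (P + M.length + j + 1) 1)).card =
      ((Finset.range (X.length - R)).filter fun j =>
        IsCross r (vtx X (R + j) 1) (vtx X (R + j + 1) 1)).card := by
    refine card_filter_congr' fun j _ => ?_
    rw [vtx_splice_right h.le h.lt.le h.sum_eq j, add_assoc,
      vtx_splice_right h.le h.lt.le h.sum_eq (j + 1), ← add_assoc]
  rw [e1, e2, e3]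
  ring

end SpliceHyp

end SpliceShape

/-! ### The shape of `upperWord t β` -/

section UpperShape

variable {t : ℕ} {β : List (Fin 4)}

/-- The hypotheses on the body `β` of an upper word: read from `(t, 1)` it ends at `(0, 1)`,
stays at heights `≥ 1` and does not intersect itself. [folklore] -/
structure UpperHyp (t : ℕ) (β : List (Fin 4)) : Prop where
  /-- the bottom row is not empty -/
  one_le : 1 ≤ t
  /-- the body returns above the root -/
  sum_eq : (β.map stepVec).sum = ![-(t : ℤ), 0]
  /-- the body stays at heights `≥ 1` -/
  nonneg : ∀ j ≤ β.length, 0 ≤ vtx β j 1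
  /-- the body is self-avoiding (endpoints included) -/
  inj : ∀ j j', j ≤ β.length → j' ≤ β.length → vtx β j = vtx β j' → j = j'

/-- Heights along the body of `upperWord`. [folklore] -/
theorem vtx_upperWord_body_one {j : ℕ} (hj : j ≤ β.length) :
    vtx (upperWord t β) (t + 1 + j) 1 = 1 + vtx β j 1 := by
  rw [vtx_upperWord_body t β hj]; simp

/-- Abscissae along the body of `upperWord`. [folklore] -/
theorem vtx_upperWord_body_zero {j : ℕ} (hj : j ≤ β.length) :
    vtx (upperWord t β) (t + 1 + j) 0 = t + vtx β j 0 := by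
  rw [vtx_upperWord_body t β hj]; simp

namespace UpperHyp

variable (h : UpperHyp t β)
include h

/-- The body is not empty. [folklore] -/
theorem one_le_length : 1 ≤ β.length := by
  by_contra h0
  have hβ : β = [] := List.eq_nil_of_length_eq_zero (by omega)
  have := congrFun h.sum_eq 0
  rw [hβ] at this
  simp at this
  have := h.one_le
  omega

/-- `upperWord` is closed. [folklore] -/
theorem sum_eq_zero : ((upperWord t β).map stepVec).sum = 0 := by
  rw [← vtx_length, length_upperWord, vtx_upperWord_length, h.sum_eq]
  ext i; fin_cases i <;> simp

/-- **`upperWord t β` is a canonical word.** [folklore] -/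
theorem isCanon : IsCanon (upperWord t β) := by
  have hlen := length_upperWord t β
  have h1 := h.one_le_length
  refine ⟨⟨by rw [hlen]; have := h.one_le; omega, h.sum_eq_zero, ?_⟩, ?_, head?_upperWord t β h.one_le⟩
  · -- self-avoiding
    intro i hi i' hi' he
    simp only [Set.mem_Iio, hlen] at hi hi'
    have hz : ∀ i < t + 2 + β.length, (i ≤ t ∧ vtx (upperWord t β) i 0 = i ∧ vtx (upperWord t β) i 1 = 0) ∨
        (∃ j ≤ β.length, i = t + 1 + j) := by
      intro i hi
      rcases Nat.lt_or_ge t i with h1 | h1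
      · exact Or.inr ⟨i - (t + 1), by omega, by omega⟩
      · exact Or.inl ⟨h1, vtx_upperWord_bottom t β h1⟩
    rcases hz i hi with ⟨hi1, x1, y1⟩ | ⟨j, hj, rfl⟩ <;>
      rcases hz i' hi' with ⟨hi1', x1', y1'⟩ | ⟨j', hj', hii'⟩
    · have := congrFun he 0
      rw [x1, x1'] at this
      exact_mod_cast this
    · have := congrFun he 1
      rw [y1, hii', vtx_upperWord_body_one hj'] at this
      have := h.nonneg j' hj'
      omega
    · have := congrFun he 1
      rw [y1', vtx_upperWord_body_one hj] at this
      have := h.nonneg j hj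
      omega
    · rw [hii', vtx_upperWord_body t β hj, vtx_upperWord_body t β hj'] at he
      have := h.inj j j' hj hj' (add_left_cancel he)
      omega
  · -- rooted
    intro i hi
    rw [hlen] at hi
    rw [key_le_key]
    simp only [Pi.zero_apply]
    rcases Nat.lt_or_ge t i with h1 | h1
    · obtain ⟨j, rfl⟩ : ∃ j, i = t + 1 + j := ⟨i - (t + 1), by omega⟩
      left
      rw [vtx_upperWord_body_one (by omega)]
      have := h.nonneg j (by omega)
      omega
    · right
      obtain ⟨x1, y1⟩ := vtx_upperWord_bottom t β h1
      rw [x1, y1]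
      exact ⟨rfl, by positivity⟩

/-- The bottom row of `upperWord t β` has width `t`. [folklore] -/
theorem bottomWidth_eq : bottomWidth (bonds (upperWord t β)) = t := by
  have hlen := length_upperWord t β
  rw [bottomWidth_bonds, h.isCanon.2.1.yMin_bonds, hlen]
  apply card_filter_range_eq (by omega)
  intro i hi
  constructor
  · rintro ⟨h1, h2⟩
    by_contra hit
    rcases Nat.lt_or_ge t i with h3 | h3
    · obtain ⟨j, rfl⟩ : ∃ j, i = t + 1 + j := ⟨i - (t + 1), by omega⟩
      rcases Nat.lt_or_ge j β.length with h4 | h4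
      · rw [show t + 1 + j + 1 = t + 1 + (j + 1) by ring,
          vtx_upperWord_body_one (show j + 1 ≤ β.length from h4)] at h2
        have := h.nonneg (j + 1) h4
        omega
      · obtain rfl : j = β.length := by omega
        rw [vtx_upperWord_body_one le_rfl, vtx_length, h.sum_eq] at h1
        simp at h1
    · rw [show i = t by omega, show t + 1 = t + 1 + 0 from rfl,
        vtx_upperWord_body_one (Nat.zero_le _), vtx_zero] at h2
      simp at h2
  · intro hit
    exact ⟨(vtx_upperWord_bottom t β hit.le).2, (vtx_upperWord_bottom t β hit).2⟩

/-- The body of `upperWord t β` is `β`. [folklore] -/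
theorem body_eq : ((upperWord t β).drop (bottomWidth (bonds (upperWord t β)) + 1)).take
    ((upperWord t β).length - (bottomWidth (bonds (upperWord t β)) + 2)) = β := by
  rw [h.bottomWidth_eq, length_upperWord, show t + 2 + β.length - (t + 2) = β.length by omega,
    take_drop_upperWord]

open Classical in
/-- **The vertical bonds of `upperWord t β`**, row by row: those of the body, plus the two
of the bottom cell row. [folklore] -/
theorem rowVerticalBonds_eq (r : ℤ) : rowVerticalBonds (bonds (upperWord t β)) r =
    ((Finset.range β.length).filter fun j => IsCross r (1 + vtx β j 1) (1 + vtx β (j + 1) 1)).card +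
      if r = 0 then 2 else 0 := by
  have hlen := length_upperWord t β
  rw [rowVerticalBonds_split (upperWord t β) (Nat.le_add_right (t + 1) β.length) (by rw [hlen]; omega),
    Nat.add_sub_cancel_left, hlen, show t + 2 + β.length - (t + 1 + β.length) = 1 by omega]
  -- the bottom row `E^t N`: one vertical bond, in row `0`
  have e1 : ((Finset.range (t + 1)).filter fun i =>
      IsCross r (vtx (upperWord t β) i 1) (vtx (upperWord t β) (i + 1) 1)).card = if r = 0 then 1 else 0 := by
    have h0 : ((Finset.range t).filter fun i =>
        IsCross r (vtx (upperWord t β) i 1) (vtx (upperWord t β) (i + 1) 1)).card = 0 := by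
      rw [Finset.card_eq_zero, Finset.filter_eq_empty_iff]
      intro i hi
      rw [Finset.mem_range] at hi
      rw [(vtx_upperWord_bottom t β hi.le).2, (vtx_upperWord_bottom t β hi).2, IsCross]
      omega
    have hval : IsCross r (vtx (upperWord t β) t 1) (vtx (upperWord t β) (t + 1) 1) ↔ r = 0 := by
      rw [show t + 1 = t + 1 + 0 from rfl, vtx_upperWord_body_one (Nat.zero_le _), vtx_zero,
        (vtx_upperWord_bottom t β le_rfl).2, IsCross]
      simp only [Pi.zero_apply, add_zero]
      omega
    rw [Finset.range_add_one, Finset.filter_insert]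
    by_cases hr : r = 0
    · rw [if_pos (hval.2 hr), if_pos hr, Finset.card_insert_of_notMem (by simp), h0]
    · rw [if_neg (fun h' => hr (hval.1 h')), if_neg hr, h0]
  -- the body
  have e2 : ((Finset.range β.length).filter fun j =>
      IsCross r (vtx (upperWord t β) (t + 1 + j) 1) (vtx (upperWord t β) (t + 1 + j + 1) 1)).card =
      ((Finset.range β.length).filter fun j => IsCross r (1 + vtx β j 1) (1 + vtx β (j + 1) 1)).card := by
    refine card_filter_congr' fun j hj => ?_
    rw [Finset.mem_range] at hj
    rw [vtx_upperWord_body_one hj.le, add_assoc, vtx_upperWord_body_one hj]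
  -- the final `S`: one vertical bond, in row `0`
  have e3 : ((Finset.range 1).filter fun j => IsCross r (vtx (upperWord t β) (t + 1 + β.length + j) 1)
      (vtx (upperWord t β) (t + 1 + β.length + j + 1) 1)).card = if r = 0 then 1 else 0 := by
    have hy : vtx (upperWord t β) (t + 1 + β.length) 1 = 1 := by
      rw [vtx_upperWord_body_one le_rfl, vtx_length, h.sum_eq]; simp
    have hy' : vtx (upperWord t β) (t + 1 + β.length + 1) 1 = 0 := by
      rw [show t + 1 + β.length + 1 = (upperWord t β).length by rw [hlen]; ring, vtx_length,
        h.sum_eq_zero]; rfl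
    have hval : IsCross r (vtx (upperWord t β) (t + 1 + β.length) 1)
        (vtx (upperWord t β) (t + 1 + β.length + 1) 1) ↔ r = 0 := by
      rw [hy, hy', IsCross]; omega
    rw [Finset.range_one, Finset.filter_singleton, Nat.add_zero]
    by_cases hr : r = 0
    · rw [if_pos (hval.2 hr), if_pos hr, Finset.card_singleton]
    · rw [if_neg (fun h' => hr (hval.1 h')), if_neg hr, Finset.card_empty]
  rw [e1, e2, e3]
  split_ifs <;> ring

end UpperHyp

end UpperShape
/-! ### Letter counts -/

section Counts

/-- Horizontal letters are `E`'s and `W`'s. [folklore] -/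
theorem hcount_eq_count_add_count (w : List (Fin 4)) : hcount w = w.count 0 + w.count 1 := by
  induction w with
  | nil => simp [hcount]
  | cons a w ih =>
    have : hcount (a :: w) = hcount w + if a.val < 2 then 1 else 0 := by
      simp [hcount, List.countP_cons]
    rw [this, ih, List.count_cons, List.count_cons]
    fin_cases a <;> simp <;> omega

/-- A closed word has as many `E`'s as `W`'s, so `hcount = 2 #E`. [folklore] -/
theorem hcount_eq_two_mul_count (w : List (Fin 4)) (hc : (w.map stepVec).sum = 0) :
    hcount w = 2 * w.count 0 := by
  have h0 := sum_map_stepVec_apply_zero w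
  rw [hc] at h0
  simp only [Pi.zero_apply] at h0
  rw [hcount_eq_count_add_count]
  omega

/-- … and `hcount = 2 #W`. [folklore] -/
theorem hcount_eq_two_mul_count_one (w : List (Fin 4)) (hc : (w.map stepVec).sum = 0) :
    hcount w = 2 * w.count 1 := by
  have h0 := sum_map_stepVec_apply_zero w
  rw [hc] at h0
  simp only [Pi.zero_apply] at h0
  rw [hcount_eq_count_add_count]
  omega

/-- `hcount` of a constant horizontal word. [folklore] -/
theorem hcount_replicate_one (t : ℕ) : hcount (List.replicate t (1 : Fin 4)) = t := by
  simp [hcount, List.countP_replicate]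

variable {W : List (Fin 4)}

open Classical in
/-- **The vertical letters are the vertical bonds, row by row**: for a word with ordinates in
`[0, Y]`, `|W| = hcount W + Σ_{r < Y} rowVerticalBonds r`. [folklore] -/
theorem length_eq_hcount_add_sum (Y : ℕ) (hy : ∀ i ≤ W.length, 0 ≤ vtx W i 1 ∧ vtx W i 1 ≤ Y) :
    W.length = hcount W + ∑ r ∈ Finset.range Y, rowVerticalBonds (bonds W) r := by
  -- the vertical steps
  have hsplit := Finset.card_filter_add_card_filter_not (s := Finset.range W.length)
    (p := fun i => vtx W (i + 1) 1 = vtx W i 1)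
  rw [Finset.card_range, ← hcount_eq_card_filter] at hsplit
  rw [← hsplit]
  congr 1
  -- each vertical step crosses exactly one row `r = min (y i) (y (i+1)) ∈ [0, Y)`
  rw [Finset.card_eq_sum_card_fiberwise (f := fun i => (min (vtx W i 1) (vtx W (i + 1) 1)).toNat)
    (t := Finset.range Y)]
  · refine Finset.sum_congr rfl fun r hr => ?_
    rw [rowVerticalBonds_bonds, Finset.filter_filter]
    refine card_filter_congr' fun i hi => ?_
    rw [Finset.mem_range] at hi
    have h1 := hy i hi.le
    have h2 := hy (i + 1) hi
    rw [IsCross]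
    rcases dy_cases W hi with h | h | h <;> omega
  · intro i hi
    simp only [Finset.coe_filter, Finset.mem_range, Set.mem_setOf_eq] at hi
    simp only [Finset.coe_range, Set.mem_Iio]
    have h1 := hy i hi.1.le
    have h2 := hy (i + 1) hi.1
    rcases dy_cases W hi.1 with h | h | h <;> omega

end Counts

/-! ### Statistics read off a height profile -/

section Profile

variable {W : List (Fin 4)}

/-- The bottom row from the height profile: heights `0` up to time `w`, then `≥ 1` until the
last vertex. [folklore] -/
theorem bottomWidth_of_profile (hr : IsRooted W) {w : ℕ} (hw : w + 2 ≤ W.length)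
    (h0 : ∀ i ≤ w, vtx W i 1 = 0) (h1 : ∀ i, w + 1 ≤ i → i ≤ W.length - 1 → 1 ≤ vtx W i 1) :
    bottomWidth (bonds W) = w := by
  rw [bottomWidth_bonds, hr.yMin_bonds]
  apply card_filter_range_eq (by omega)
  intro i hi
  constructor
  · rintro ⟨e1, e2⟩
    by_contra hiw
    rcases Nat.lt_or_ge w i with h | h
    · have := h1 i (by omega) (by omega); omega
    · have := h1 (i + 1) (by omega) (by omega); omega
  · intro hiw
    exact ⟨h0 i hiw.le, h0 (i + 1) hiw⟩

open Classical in
/-- No vertical bond in a negative row when all heights are `≥ 0`. [folklore] -/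
theorem rowVerticalBonds_eq_zero_of_neg (hy : ∀ i ≤ W.length, 0 ≤ vtx W i 1) {r : ℤ} (hr : r < 0) :
    rowVerticalBonds (bonds W) r = 0 := by
  rw [rowVerticalBonds_bonds, Finset.card_eq_zero, Finset.filter_eq_empty_iff]
  intro i hi
  rw [Finset.mem_range] at hi
  have h1 := hy i hi.le
  have h2 := hy (i + 1) hi
  rw [IsCross]
  omega

open Classical in
/-- No vertical bond above row `Y - 1` when all heights are `≤ Y`. [folklore] -/
theorem rowVerticalBonds_eq_zero_of_ge (Y : ℤ) (hy : ∀ i ≤ W.length, vtx W i 1 ≤ Y) {r : ℤ}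
    (hr : Y ≤ r) : rowVerticalBonds (bonds W) r = 0 := by
  rw [rowVerticalBonds_bonds, Finset.card_eq_zero, Finset.filter_eq_empty_iff]
  intro i hi
  rw [Finset.mem_range] at hi
  have h1 := hy i hi.le
  have h2 := hy (i + 1) hi
  rw [IsCross]
  omega

/-- All heights of a closed rooted word are at most `yMax`. [folklore] -/
theorem vtx_le_yMax (hc : (W.map stepVec).sum = 0) {i : ℕ} (hi : i ≤ W.length) :
    vtx W i 1 ≤ yMax (bonds W) := by
  rcases hi.lt_or_eq with hi | rfl
  · exact le_yMax_bonds W hi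
  · rw [vtx_length, hc]; exact yMax_bonds_nonneg W

/-- In a canonical word `Is242 k` reads: `yMax = 2k - 1` and the rows `0, …, 2k-2` carry
`2, 4, 2, …` vertical bonds. [cite: Rechnitzer2006Haruspicy2, Definition 18] -/
theorem IsCanon.is242_iff (h : IsCanon W) (k : ℕ) : Is242 k (bonds W) ↔
    yMax (bonds W) = ((2 * k - 1 : ℕ) : ℤ) ∧
      ∀ i : ℕ, i < 2 * k - 1 → rowVerticalBonds (bonds W) i = if Even i then 2 else 4 := by
  rw [Is242, h.2.1.yMin_bonds, sub_zero]
  simp only [zero_add]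

end Profile

/-! ### The band decomposition is unique; heights in the band decomposition -/

namespace IsBand

variable {W : List (Fin 4)} {w p q : ℕ}

/-- Heights up to the up-step are `≤ 2`. [folklore] -/
theorem le_two_of_le (hb : IsBand W w p q) {i : ℕ} (hi : i ≤ p) : vtx W i 1 ≤ 2 := by
  rcases Nat.lt_or_ge w i with h | h
  · exact (hb.band₁ i h hi).2
  · rw [(hb.bottom i h).2]; norm_num

/-- Heights after the down-step are `≤ 2`. [folklore] -/
theorem le_two_of_gt (hb : IsBand W w p q) (hc : (W.map stepVec).sum = 0) {i : ℕ} (hi : q < i)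
    (hiN : i ≤ W.length) : vtx W i 1 ≤ 2 := by
  rcases hiN.lt_or_eq with h | rfl
  · exact (hb.band₂ i hi (by omega)).2
  · rw [vtx_length, hc]; norm_num

/-- The height is `0` exactly on the bottom row (before the last vertex). [folklore] -/
theorem one_le_of_gt (hb : IsBand W w p q) {i : ℕ} (hi : w < i) (hiN : i ≤ W.length - 1) :
    1 ≤ vtx W i 1 := by
  rcases le_or_gt i p with h | h
  · exact (hb.band₁ i hi h).1
  rcases le_or_gt i q with h' | h'
  · have := hb.top i h h'; omega
  · exact (hb.band₂ i h' hiN).1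

/-- **Uniqueness of the band decomposition.** [folklore] -/
theorem unique {w' p' q' : ℕ} (hb : IsBand W w p q) (hb' : IsBand W w' p' q') : p = p' ∧ q = q' := by
  have hp : p = p' := by
    by_contra hne
    rcases Nat.lt_or_gt_of_ne hne with h | h
    · have h1 := hb'.le_two_of_le (show p + 1 ≤ p' by omega)
      rw [hb.y_p1] at h1
      norm_num at h1
    · have h1 := hb.le_two_of_le (show p' + 1 ≤ p by omega)
      rw [hb'.y_p1] at h1
      norm_num at h1
  subst hp
  refine ⟨rfl, ?_⟩
  by_contra hne
  rcases Nat.lt_or_gt_of_ne hne with h | h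
  · have h1 := hb'.top (q + 1) (by have := hb.p_lt_q; omega) h
    rw [hb.y_q1] at h1
    norm_num at h1
  · have h1 := hb.top (q' + 1) (by have := hb'.p_lt_q; omega) h
    rw [hb'.y_q1] at h1
    norm_num at h1

end IsBand

/-! ### `firstTop`, `body`, `glue` -/

section Glue

open Classical in
/-- The first time a word reaches height `3` (`0` if it never does): for a building block, one
step after the up-step of its top cell row. [folklore] -/
def firstTop (Q : List (Fin 4)) : ℕ := if h : ∃ i, vtx Q i 1 = 3 then Nat.find h else 0

/-- Characterisation of `firstTop`. [folklore] -/
theorem firstTop_eq {Q : List (Fin 4)} {P : ℕ} (hP : vtx Q P 1 = 3) (hlt : ∀ i < P, vtx Q i 1 < 3) :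
    firstTop Q = P := by
  classical
  have hex : ∃ i, vtx Q i 1 = 3 := ⟨P, hP⟩
  rw [firstTop, dif_pos hex, Nat.find_eq_iff]
  exact ⟨hP, fun i hi h3 => absurd h3 (hlt i hi).ne⟩

/-- The body `β` of an upper word `E^t N β S` (`t` its bottom row). [folklore] -/
def body (W' : List (Fin 4)) : List (Fin 4) :=
  (W'.drop (bottomWidth (bonds W') + 1)).take (W'.length - (bottomWidth (bonds W') + 2))

/-- **Gluing** a building block `Q` under an upper polygon `W'` along the duplicated row
(Rechnitzer's Fig. 10, read on canonical words): the top run of `Q` (of the width `t` of the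
bottom row of `W'`) is replaced by the body of `W'`. [cite: Rechnitzer2006Haruspicy2, Lemma 23 (Fig. 10)] -/
def glue (W' Q : List (Fin 4)) : List (Fin 4) :=
  splice Q (firstTop Q) (firstTop Q + bottomWidth (bonds W')) (body W')

end Glue

/-! ### The data of an upper polygon `W' ∈ c242Words k i t` -/

section UpperData

variable {W' : List (Fin 4)}

/-- Vertices of the body. [folklore] -/
theorem vtx_body {j : ℕ} (hj : j ≤ W'.length - (bottomWidth (bonds W') + 2)) :
    vtx (body W') j = vtx W' (bottomWidth (bonds W') + 1 + j) - vtx W' (bottomWidth (bonds W') + 1) := by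
  rw [body, vtx_take _ hj, vtx_drop]

/-- Length of the body. [folklore] -/
theorem length_body (h : bottomWidth (bonds W') + 2 ≤ W'.length) :
    (body W').length = W'.length - (bottomWidth (bonds W') + 2) := by
  rw [body, List.length_take, List.length_drop]
  omega

/-- **An upper polygon is `upperWord t (body W')`** with `UpperHyp t (body W')`, where `t` is its
bottom row: the word form of `IsCanon.bottom_row`. [cite: Rechnitzer2006Haruspicy2, Lemma 23] -/
theorem IsCanon.eq_upperWord (h : IsCanon W') (h2 : rowVerticalBonds (bonds W') 0 = 2) :
    UpperHyp (bottomWidth (bonds W')) (body W') ∧ W' = upperWord (bottomWidth (bonds W')) (body W') := by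
  obtain ⟨ht1, htN, hbot, ⟨hxt, hyt⟩, ⟨hxN, hyN⟩, hge1⟩ := h.bottom_row h2
  have hlen := length_body htN
  have hinj := h.1.2.2
  refine ⟨⟨ht1, ?_, fun j hj => ?_, fun j j' hj hj' he => ?_⟩, ?_⟩
  · rw [← vtx_length, hlen, vtx_body le_rfl,
      show bottomWidth (bonds W') + 1 + (W'.length - (bottomWidth (bonds W') + 2)) = W'.length - 1 by omega]
    ext i; fin_cases i
    · simp [hxN, hxt]
    · simp [hyN, hyt]
  · rw [hlen] at hj
    rw [vtx_body hj, Pi.sub_apply, hyt]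
    have := hge1 (bottomWidth (bonds W') + 1 + j) (by omega) (by omega)
    omega
  · rw [hlen] at hj hj'
    rw [vtx_body hj, vtx_body hj', sub_left_inj] at he
    have := hinj (show bottomWidth (bonds W') + 1 + j ∈ Set.Iio W'.length by simp; omega)
      (show bottomWidth (bonds W') + 1 + j' ∈ Set.Iio W'.length by simp; omega) he
    omega
  · -- the word: `W'.take t = E^t`, `W'[t] = N`, `W'[N-1] = S`
    have e0 : W'.take (bottomWidth (bonds W')) = List.replicate (bottomWidth (bonds W')) 0 := by
      apply List.ext_getElem
      · simp; omega
      · intro i hi1 hi2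
        rw [List.length_take] at hi1
        rw [List.getElem_take, List.getElem_replicate]
        exact eq_zero_of_dx W' (by omega) (by
          rw [(hbot (i + 1) (by omega)).1, (hbot i (by omega)).1]; push_cast; ring)
    have e1 : W'[bottomWidth (bonds W')]'(by omega) = 2 :=
      eq_two_of_dy W' (by omega) (by rw [hyt, (hbot _ le_rfl).2]; norm_num)
    have e2 : W'[W'.length - 1]'(by omega) = 3 :=
      eq_three_of_dy W' (by omega) (by
        rw [show W'.length - 1 + 1 = W'.length by omega, vtx_length, h.1.2.1, hyN]; rfl)
    have s1 : W' = W'.take (bottomWidth (bonds W')) ++ W'.drop (bottomWidth (bonds W')) :=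
      (List.take_append_drop _ W').symm
    have s2 : W'.drop (bottomWidth (bonds W')) =
        W'[bottomWidth (bonds W')]'(by omega) :: W'.drop (bottomWidth (bonds W') + 1) :=
      List.drop_eq_getElem_cons _
    have s3 : W'.drop (bottomWidth (bonds W') + 1) =
        body W' ++ (W'.drop (bottomWidth (bonds W') + 1)).drop (W'.length - (bottomWidth (bonds W') + 2)) :=
      (List.take_append_drop _ _).symm
    have s4 : (W'.drop (bottomWidth (bonds W') + 1)).drop (W'.length - (bottomWidth (bonds W') + 2)) =
        [W'[W'.length - 1]'(by omega)] := by
      rw [List.drop_drop, show bottomWidth (bonds W') + 1 + (W'.length - (bottomWidth (bonds W') + 2)) =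
        W'.length - 1 by omega, List.drop_eq_getElem_cons (by omega),
        show W'.length - 1 + 1 = W'.length by omega, List.drop_length]
    rw [s2, s3, s4, e0, e1, e2] at s1
    rw [upperWord]
    conv_lhs => rw [s1]
    simp [List.append_assoc]

/-- The data of a word of `c242Words k i t`, `k ≥ 1`. [cite: Rechnitzer2006Haruspicy2, Definition 18 and Lemma 23] -/
theorem upper_data {k i t : ℕ} (hk : 1 ≤ k) (hW : W' ∈ c242Words k i t) :
    UpperHyp t (body W') ∧ W' = upperWord t (body W') ∧ (body W').length = W'.length - (t + 2) ∧
      yMax (bonds W') = 2 * k - 1 ∧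
      (∀ n : ℕ, n < 2 * k - 1 → rowVerticalBonds (bonds W') n = if Even n then 2 else 4) ∧
      (∀ r : ℤ, r < 0 → rowVerticalBonds (bonds W') r = 0) := by
  rw [mem_c242Words] at hW
  obtain ⟨-, hcan, -, h242, hbw⟩ := hW
  rw [hcan.is242_iff] at h242
  obtain ⟨hmax, hrows⟩ := h242
  have h0 : rowVerticalBonds (bonds W') 0 = 2 := by
    have := hrows 0 (by omega)
    simpa using this
  obtain ⟨hU, heq⟩ := hcan.eq_upperWord h0
  rw [hbw] at hU heq
  have htN := (hcan.bottom_row h0).2.1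
  rw [hbw] at htN
  refine ⟨hU, heq, by rw [length_body (hbw.symm ▸ htN), hbw], by rw [hmax]; push_cast [show 1 ≤ 2 * k by omega]; ring,
    hrows, fun r hr => rowVerticalBonds_eq_zero_of_neg (fun i hi => hcan.2.1.vtx_one_nonneg' hcan.1.2.1 hi) hr⟩

end UpperData

/-! ### The data of a building block `Q ∈ bbWords M t w` -/

section BlockData

variable {Q : List (Fin 4)}

/-- The top row of a word with a band decomposition and all heights `≤ 3` is the straight run:
`topWidth = q - (p + 1)`. [cite: Rechnitzer2006Haruspicy2, Lemma 23] -/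
theorem IsBand.topWidth_eq {w p q : ℕ} (hb : IsBand Q w p q) (hsap : IsSAP Q)
    (hmax : yMax (bonds Q) = 3) : topWidth (bonds Q) = q - (p + 1) := by
  have h3 : ∀ i ≤ Q.length, vtx Q i 1 ≤ 3 := fun i hi => hmax ▸ vtx_le_yMax hsap.2.1 hi
  obtain ⟨-, hrun, -⟩ := hb.top_run hsap fun i hi => h3 i hi.le
  have hq := hb.q_le
  rw [topWidth_bonds, hmax]
  apply card_filter_range_eq_Ico (by omega)
  intro i hi
  constructor
  · rintro ⟨e1, e2⟩
    have hc := hsap.2.1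
    constructor
    · by_contra hlt
      have := hb.le_two_of_le (show i ≤ p by omega); omega
    · by_contra hge
      rcases (show i = q ∨ q < i by omega) with rfl | hqi
      · rw [hb.y_q1] at e2; norm_num at e2
      · have := hb.le_two_of_gt hc hqi hi.le; omega
  · rintro ⟨h1, h2⟩
    exact ⟨(hrun i h1 h2.le).1, (hrun (i + 1) (by omega) h2).1⟩

/-- **The data of a building block** `Q ∈ bbWords M t w`: its band decomposition `IsBand Q w p q`
with the top run of width `t = q - (p + 1)`, the letters `W` along it, `firstTop Q = p + 1`, and
the bookkeeping of its vertical bonds. [cite: Rechnitzer2006Haruspicy2, Lemma 21 and Lemma 23] -/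
theorem block_data {M t w : ℕ} (hQ : Q ∈ bbWords M t w) :
    ∃ p q, IsBand Q w p q ∧ q = p + 1 + t ∧ (vtx Q p 0 : ℤ) = vtx Q (q + 1) 0 + t ∧
      (∀ j, p + 1 ≤ j → j ≤ q → vtx Q j 1 = 3) ∧
      (Q.drop (p + 1)).take t = List.replicate t 1 ∧ firstTop Q = p + 1 ∧
      (∀ i ≤ Q.length, vtx Q i 1 ≤ 3) ∧
      rowVerticalBonds (bonds Q) 0 = 2 ∧ rowVerticalBonds (bonds Q) 1 = 4 ∧
      rowVerticalBonds (bonds Q) 2 = 2 ∧ (∀ r : ℤ, 3 ≤ r → rowVerticalBonds (bonds Q) r = 0) := by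
  rw [mem_bbWords] at hQ
  obtain ⟨-, hcan, -, h242, htw, hbw⟩ := hQ
  rw [hcan.is242_iff] at h242
  obtain ⟨hmax, hrows⟩ := h242
  norm_num at hmax
  have h0 : rowVerticalBonds (bonds Q) 0 = 2 := by simpa using hrows 0 (by norm_num)
  have h1 : rowVerticalBonds (bonds Q) 1 = 4 := by simpa using hrows 1 (by norm_num)
  have h2 : rowVerticalBonds (bonds Q) 2 = 2 := by simpa using hrows 2 (by norm_num)
  obtain ⟨p, q, hb⟩ := hcan.exists_isBand h0 h1.le h2
  rw [hbw] at hb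
  have hsap := hcan.1
  have h3 : ∀ i ≤ Q.length, vtx Q i 1 ≤ 3 := fun i hi => hmax ▸ vtx_le_yMax hsap.2.1 hi
  obtain ⟨hq, hrun, hlet⟩ := hb.top_run hsap fun i hi => h3 i hi.le
  have ht : q - (p + 1) = t := by rw [← htw, hb.topWidth_eq hsap hmax]
  have hqt : q = p + 1 + t := by have := hb.p_lt_q; omega
  have hN := hb.q_le
  refine ⟨p, q, hb, hqt, ?_, fun j hj1 hj2 => (hrun j hj1 hj2).1, ?_, ?_, h3, h0, h1, h2, fun r hr =>
    rowVerticalBonds_eq_zero_of_ge 3 h3 hr⟩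
  · have := hb.x_p_eq
    have e : (vtx Q p 0 - vtx Q (q + 1) 0).toNat = t := by omega
    rw [e] at this
    exact this
  · apply List.ext_getElem
    · simp; omega
    · intro i hi1 hi2
      rw [List.length_take, List.length_drop] at hi1
      rw [List.getElem_take, List.getElem_drop, List.getElem_replicate]
      exact hlet (p + 1 + i) (by omega) (by omega)
  · exact firstTop_eq hb.y_p1 fun i hi => by have := hb.le_two_of_le (show i ≤ p by omega); omega

end BlockData
/-! ### The straight body `W^T` and the rectangle word `E^T N W^T S` -/

section Rect

variable {T : ℕ}

/-- Vertices of the straight body `W^T`: `(-j, 0)`. [folklore] -/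
theorem vtx_replicate_one {j : ℕ} (hj : j ≤ T) :
    vtx (List.replicate T (1 : Fin 4)) j 0 = -(j : ℤ) ∧ vtx (List.replicate T (1 : Fin 4)) j 1 = 0 := by
  rw [vtx_replicate T 1 hj]
  simp

/-- The straight body `W^T` satisfies the hypotheses of an upper word (it is the body of the unit
rectangle `E^T N W^T S`). [folklore] -/
theorem upperHyp_replicate (hT : 1 ≤ T) : UpperHyp T (List.replicate T 1) := by
  refine ⟨hT, ?_, fun j hj => ?_, fun j j' hj hj' he => ?_⟩
  · rw [sum_replicate_stepVec]
    ext i; fin_cases i <;> simp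
  · rw [List.length_replicate] at hj
    rw [(vtx_replicate_one hj).2]
  · rw [List.length_replicate] at hj hj'
    have := congrFun he 0
    rw [(vtx_replicate_one hj).1, (vtx_replicate_one hj').1] at this
    omega

/-- The unit rectangle `E^T N W^T S` has height `1`. [folklore] -/
theorem yMax_rect (hT : 1 ≤ T) : yMax (bonds (upperWord T (List.replicate T 1))) = 1 := by
  have hlen := length_upperWord T (List.replicate T (1 : Fin 4))
  rw [List.length_replicate] at hlen
  refine yMax_bonds_eq zero_le_one (fun i hi => ?_) (j := T + 1) (by rw [hlen]; omega) ?_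
  · rw [hlen] at hi
    rcases Nat.lt_or_ge T i with h | h
    · obtain ⟨j, rfl⟩ : ∃ j, i = T + 1 + j := ⟨i - (T + 1), by omega⟩
      rw [vtx_upperWord_body_one (by rw [List.length_replicate]; omega), (vtx_replicate_one (by omega)).2]
      norm_num
    · rw [(vtx_upperWord_bottom T _ h).2]; norm_num
  · rw [show T + 1 = T + 1 + 0 from rfl, vtx_upperWord_body_one (Nat.zero_le _), vtx_zero]
    simp

/-- The unit rectangle `E^T N W^T S` has its two vertical bonds in row `0`. [folklore] -/
theorem rowVerticalBonds_rect (hT : 1 ≤ T) (r : ℤ) :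
    rowVerticalBonds (bonds (upperWord T (List.replicate T 1))) r = if r = 0 then 2 else 0 := by
  rw [(upperHyp_replicate hT).rowVerticalBonds_eq r, List.length_replicate]
  have : ((Finset.range T).filter fun j => IsCross r (1 + vtx (List.replicate T (1 : Fin 4)) j 1)
      (1 + vtx (List.replicate T (1 : Fin 4)) (j + 1) 1)).card = 0 := by
    rw [Finset.card_eq_zero, Finset.filter_eq_empty_iff]
    intro j hj
    rw [Finset.mem_range] at hj
    rw [(vtx_replicate_one hj.le).2, (vtx_replicate_one (show j + 1 ≤ T by omega)).2, IsCross]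
    omega
  rw [this, Nat.zero_add]

end Rect

/-! ### Splicing along the duplicated row: the common shape of gluing and cutting -/

section BandSpliceSec

variable {X M : List (Fin 4)} {T w p q : ℕ}

/-- The hypotheses of gluing/cutting along the duplicated row: a canonical word `X` with its band
decomposition `(w, p, q)`, the width `T = b - a` of the duplicated row, and a body `M` read from
`(b, 3)` satisfying the upper-word hypotheses. Gluing a polygon above a building block
(`X = Q`, `M` = the body of the polygon) and cutting a polygon along its third row
(`X = W`, `M = W^T`) are both instances. [cite: Rechnitzer2006Haruspicy2, Lemma 23 (Fig. 10)] -/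
structure BandSplice (X M : List (Fin 4)) (T w p q : ℕ) : Prop where
  /-- `X` is canonical -/
  canon : IsCanon X
  /-- the band decomposition of `X` -/
  band : IsBand X w p q
  /-- `T = b - a` -/
  x_p : vtx X p 0 = vtx X (q + 1) 0 + T
  /-- the body -/
  mid : UpperHyp T M

namespace BandSplice

/-- The replaced stretch of `X`, read from `(b, 3)`. [folklore] -/
theorem vtx_take_drop {j : ℕ} (hj : j ≤ q - (p + 1)) :
    vtx ((X.drop (p + 1)).take (q - (p + 1))) j = vtx X (p + 1 + j) - vtx X (p + 1) := by
  rw [vtx_take _ hj, vtx_drop]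

variable (h : BandSplice X M T w p q)
include h

/-- The splice hypotheses hold with `H = 3`. [folklore] -/
theorem spliceHyp : SpliceHyp X (p + 1) q M 3 := by
  have hb := h.band
  have hc := h.canon.1.2.1
  refine ⟨by omega, hb.p_lt_q, by have := hb.q_le; omega, ?_, fun i hi hio => ?_, fun j hj => ?_, h.mid.inj⟩
  · rw [h.mid.sum_eq]
    ext i; fin_cases i
    · simp only [Fin.zero_eta, Fin.isValue, Matrix.cons_val_zero, Pi.sub_apply]
      rw [← hb.x_q1, hb.x_p1, h.x_p]; ring
    · simp only [Fin.mk_one, Fin.isValue, Matrix.cons_val_one, Matrix.cons_val_fin_one, Pi.sub_apply]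
      rw [hb.y_q, hb.y_p1]; ring
  · rcases hio with hio | hio
    · have := hb.le_two_of_le (show i ≤ p by omega); omega
    · have := hb.le_two_of_gt hc hio hi; omega
  · rw [Pi.add_apply, hb.y_p1]
    have := h.mid.nonneg j hj
    omega

/-- Length of the splice. [folklore] -/
theorem length_eq : (splice X (p + 1) q M).length = p + 1 + M.length + (X.length - q) :=
  h.spliceHyp.length_eq

/-- **The splice is canonical.** [folklore] -/
theorem isCanon : IsCanon (splice X (p + 1) q M) := by
  have := h.band.le_p
  have := h.band.one_le
  have := h.band.q_le
  exact h.spliceHyp.isCanon h.canon (by norm_num) (by omega)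

/-- Vertices of the splice, first zone. [folklore] -/
theorem vtx_left {i : ℕ} (hi : i ≤ p + 1) : vtx (splice X (p + 1) q M) i = vtx X i :=
  vtx_splice_left (by have := h.band.p_lt_q; have := h.band.q_le; omega) hi

/-- Vertices of the splice, middle zone. [folklore] -/
theorem vtx_mid {j : ℕ} (hj : j ≤ M.length) :
    vtx (splice X (p + 1) q M) (p + 1 + j) = vtx X (p + 1) + vtx M j :=
  vtx_splice_mid (by have := h.band.p_lt_q; have := h.band.q_le; omega) hj

/-- Heights in the middle zone. [folklore] -/
theorem vtx_mid_one {j : ℕ} (hj : j ≤ M.length) :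
    vtx (splice X (p + 1) q M) (p + 1 + j) 1 = 3 + vtx M j 1 := by
  rw [h.vtx_mid hj, Pi.add_apply, h.band.y_p1]

/-- Abscissae in the middle zone. [folklore] -/
theorem vtx_mid_zero {j : ℕ} (hj : j ≤ M.length) :
    vtx (splice X (p + 1) q M) (p + 1 + j) 0 = vtx X p 0 + vtx M j 0 := by
  rw [h.vtx_mid hj, Pi.add_apply, h.band.x_p1]

/-- Vertices of the splice, last zone. [folklore] -/
theorem vtx_right (j : ℕ) : vtx (splice X (p + 1) q M) (p + 1 + M.length + j) = vtx X (q + j) :=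
  vtx_splice_right h.spliceHyp.le h.spliceHyp.lt.le h.spliceHyp.sum_eq j

/-- The last vertex of the body is `(a, 3)`. [folklore] -/
theorem vtx_mid_length : vtx (splice X (p + 1) q M) (p + 1 + M.length) 0 = vtx X (q + 1) 0 ∧
    vtx (splice X (p + 1) q M) (p + 1 + M.length) 1 = 3 := by
  rw [h.vtx_mid_zero le_rfl, h.vtx_mid_one le_rfl, vtx_length, h.mid.sum_eq, h.x_p]
  simp

/-- **The highest row**: `yMax` of the splice is `yMax` of the upper word plus `2`. [folklore] -/
theorem yMax_eq : yMax (bonds (splice X (p + 1) q M)) = yMax (bonds (upperWord T M)) + 2 := by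
  have hlenU := length_upperWord T M
  have hlen := h.length_eq
  have hS := h.spliceHyp
  -- `yMax U ≥ 1`
  have hU1 : 1 ≤ yMax (bonds (upperWord T M)) := by
    have := le_yMax_bonds (upperWord T M) (i := T + 1) (by rw [hlenU]; omega)
    rw [show T + 1 = T + 1 + 0 from rfl, vtx_upperWord_body_one (Nat.zero_le _), vtx_zero] at this
    simpa using this
  -- the witness: the highest vertex of `U` lies on its body
  obtain ⟨j₀, hj₀, hy₀⟩ : ∃ j₀ ≤ M.length, 1 + vtx M j₀ 1 = yMax (bonds (upperWord T M)) := by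
    rcases yMax_bonds_cases (upperWord T M) with h0 | ⟨i₀, hi₀, he⟩
    · omega
    · rw [hlenU] at hi₀
      rcases Nat.lt_or_ge T i₀ with h1 | h1
      · obtain ⟨j₀, rfl⟩ : ∃ j₀, i₀ = T + 1 + j₀ := ⟨i₀ - (T + 1), by omega⟩
        refine ⟨j₀, by omega, ?_⟩
        rw [← he, vtx_upperWord_body_one (by omega)]
      · rw [(vtx_upperWord_bottom T M h1).2] at he
        omega
  refine yMax_bonds_eq (by omega) (fun i hi => ?_) (j := p + 1 + j₀) (by rw [hlen]; have := h.band.q_le; omega) ?_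
  · rcases hS.zone hi.le with ⟨-, e1, y1⟩ | ⟨j, hj, rfl, -⟩ | ⟨j, -, -, rfl, e1, y1⟩
    · rw [e1]; omega
    · rw [h.vtx_mid_one hj]
      have := le_yMax_bonds (upperWord T M) (i := T + 1 + j) (by rw [hlenU]; omega)
      rw [vtx_upperWord_body_one hj] at this
      omega
    · rw [e1]; omega
  · rw [h.vtx_mid_one hj₀, ← hy₀]; ring

/-- **The bottom row** of the splice is that of `X`. [folklore] -/
theorem bottomWidth_eq : bottomWidth (bonds (splice X (p + 1) q M)) = w := by
  have hb := h.band
  have hlen := h.length_eq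
  have hS := h.spliceHyp
  refine bottomWidth_of_profile h.isCanon.2.1 (by rw [hlen]; have := hb.le_p; omega)
    (fun i hi => ?_) (fun i h1 h2 => ?_)
  · rw [h.vtx_left (by have := hb.le_p; omega)]
    exact (hb.bottom i hi).2
  · rcases hS.zone (show i ≤ (splice X (p + 1) q M).length by omega) with
      ⟨h3, e1, -⟩ | ⟨j, hj, rfl, -⟩ | ⟨j, hj1, hj2, rfl, e1, -⟩
    · rw [e1]; exact hb.one_le_of_gt (by omega) (by have := hb.p_lt_q; have := hb.q_le; omega)
    · rw [h.vtx_mid_one hj]; have := h.mid.nonneg j hj; omega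
    · rw [e1]
      rw [hlen] at h2
      exact hb.one_le_of_gt (by have := hb.le_p; have := hb.p_lt_q; omega) (by omega)

/-- The splice reaches height `3` first at time `p + 1`. [folklore] -/
theorem firstTop_splice : firstTop (splice X (p + 1) q M) = p + 1 := by
  refine firstTop_eq (by rw [show p + 1 = p + 1 + 0 from rfl, h.vtx_mid_one (Nat.zero_le _), vtx_zero]; simp)
    fun i hi => ?_
  rw [h.vtx_left hi.le]
  have := h.band.le_two_of_le (show i ≤ p by omega)
  omega

/-- **The band decomposition of the splice**: the same `w` and `p`, the down-step right after
the body. [folklore] -/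
theorem isBand : IsBand (splice X (p + 1) q M) w p (p + 1 + M.length) := by
  have hb := h.band
  have hlen := h.length_eq
  have h1 := hb.one_le
  have h2 := hb.le_p
  have h3 := hb.p_lt_q
  have h4 := hb.q_le
  have hN1 : (splice X (p + 1) q M).length - 1 = p + 1 + M.length + (X.length - q - 1) := by
    rw [hlen]; omega
  have hqj : q + (X.length - q - 1) = X.length - 1 := by omega
  obtain ⟨hxℓ, hyℓ⟩ := h.vtx_mid_length
  refine ⟨h1, h2, by omega, by rw [hlen]; omega, fun i hi => ?_, ?_, ?_, ?_, ?_, ?_, ?_, ?_, hyℓ, ?_, ?_,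
    fun i hi1 hi2 => ?_, fun i hi1 hi2 => ?_, fun i hi1 hi2 => ?_, ?_⟩
  · rw [h.vtx_left (by omega)]; exact hb.bottom i hi
  · rw [h.vtx_left (by omega)]; exact hb.x_w1
  · rw [h.vtx_left (by omega)]; exact hb.y_w1
  · rw [hN1, h.vtx_right, hqj]; exact hb.x_N1
  · rw [hN1, h.vtx_right, hqj]; exact hb.y_N1
  · rw [h.vtx_left (by omega)]; exact hb.y_p
  · rw [h.vtx_left le_rfl]; exact hb.y_p1
  · rw [h.vtx_left le_rfl, h.vtx_left (by omega)]; exact hb.x_p1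
  · rw [h.vtx_right 1]; exact hb.y_q1
  · rw [h.vtx_right 1, hxℓ]
  · rw [h.vtx_left (by omega)]; exact hb.band₁ i hi1 hi2
  · obtain ⟨j, rfl⟩ : ∃ j, i = p + 1 + j := ⟨i - (p + 1), by omega⟩
    rw [h.vtx_mid_one (by omega)]
    have := h.mid.nonneg j (by omega)
    omega
  · obtain ⟨j, rfl⟩ : ∃ j, i = p + 1 + M.length + j := ⟨i - (p + 1 + M.length), by omega⟩
    rw [h.vtx_right j]
    rw [hlen] at hi2
    exact hb.band₂ (q + j) (by omega) (by omega)
  · rw [h.vtx_right 1, h.vtx_left (by omega)]; exact hb.lt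

/-- The duplicated row of the splice has the same columns: `x p = x (q' + 1) + T`. [folklore] -/
theorem x_p_splice : vtx (splice X (p + 1) q M) p 0 = vtx (splice X (p + 1) q M) (p + 1 + M.length + 1) 0 + T := by
  rw [h.vtx_left (Nat.le_succ p), h.vtx_right 1, h.x_p]

/-- The body can be read off the splice. [folklore] -/
theorem take_drop : ((splice X (p + 1) q M).drop (p + 1)).take M.length = M :=
  take_drop_splice (by have := h.band.p_lt_q; have := h.band.q_le; omega)

/-- Splicing back the original stretch gives back `X`. [folklore] -/
theorem splice_back : splice (splice X (p + 1) q M) (p + 1) (p + 1 + M.length)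
    ((X.drop (p + 1)).take (q - (p + 1))) = X :=
  splice_splice h.spliceHyp.le h.spliceHyp.lt.le

open Classical in
/-- **The vertical bonds of the splice**, row by row: exchanging the bodies exchanges their
vertical bonds, `rVB(splice) r + rVB(E^T N Xmid S) (r-2) = rVB(X) r + rVB(E^T N M S) (r-2)`,
where `Xmid` is the replaced stretch of `X`. [folklore] -/
theorem rowVerticalBonds_eq (hX : UpperHyp T ((X.drop (p + 1)).take (q - (p + 1)))) (r : ℤ) :
    rowVerticalBonds (bonds (splice X (p + 1) q M)) r +
      rowVerticalBonds (bonds (upperWord T ((X.drop (p + 1)).take (q - (p + 1))))) (r - 2) =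
    rowVerticalBonds (bonds X) r + rowVerticalBonds (bonds (upperWord T M)) (r - 2) := by
  have hS := h.spliceHyp.rowVerticalBonds_eq r
  have hlenX : ((X.drop (p + 1)).take (q - (p + 1))).length = q - (p + 1) := by
    rw [List.length_take, List.length_drop]; have := h.band.q_le; omega
  have e1 : rowVerticalBonds (bonds (upperWord T ((X.drop (p + 1)).take (q - (p + 1))))) (r - 2) =
      ((Finset.range (q - (p + 1))).filter fun j =>
        IsCross r (vtx X (p + 1 + j) 1) (vtx X (p + 1 + j + 1) 1)).card + if r - 2 = 0 then 2 else 0 := by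
    rw [hX.rowVerticalBonds_eq, hlenX]
    congr 1
    refine card_filter_congr' fun j hj => ?_
    rw [Finset.mem_range] at hj
    rw [vtx_take_drop hj.le, vtx_take_drop (show j + 1 ≤ q - (p + 1) by omega),
      show p + 1 + (j + 1) = p + 1 + j + 1 by ring, Pi.sub_apply, Pi.sub_apply, h.band.y_p1,
      IsCross, IsCross]
    omega
  have e2 : rowVerticalBonds (bonds (upperWord T M)) (r - 2) =
      ((Finset.range M.length).filter fun j =>
        IsCross r ((vtx X (p + 1) + vtx M j) 1) ((vtx X (p + 1) + vtx M (j + 1)) 1)).card +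
          if r - 2 = 0 then 2 else 0 := by
    rw [h.mid.rowVerticalBonds_eq]
    congr 1
    refine card_filter_congr' fun j _ => ?_
    rw [Pi.add_apply, Pi.add_apply, h.band.y_p1, IsCross, IsCross]
    omega
  rw [e1, e2]
  omega

/-- **The top row of a cut-off building block**: splicing in the straight body `W^T` produces a
word whose top row is that body. [folklore] -/
theorem topWidth_eq_of_replicate (hM : M = List.replicate T 1) :
    topWidth (bonds (splice X (p + 1) q M)) = T := by
  have hb := h.band
  have hlen := h.length_eq
  have hS := h.spliceHyp
  have hT : M.length = T := by rw [hM, List.length_replicate]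
  have hmax : yMax (bonds (splice X (p + 1) q M)) = 3 := by
    rw [h.yMax_eq, hM, yMax_rect h.mid.one_le]; norm_num
  have hy3 : ∀ j ≤ T, vtx (splice X (p + 1) q M) (p + 1 + j) 1 = 3 := fun j hj => by
    rw [h.vtx_mid_one (by omega), hM, (vtx_replicate_one hj).2, add_zero]
  rw [topWidth_bonds, hmax, hlen, show T = p + 1 + T - (p + 1) by omega]
  apply card_filter_range_eq_Ico (by have := hb.q_le; omega)
  intro i hi
  constructor
  · rintro ⟨e1, e2⟩
    have hz := hS.zone (show i ≤ (splice X (p + 1) q M).length by rw [hlen]; omega)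
    have hz' := hS.zone (show i + 1 ≤ (splice X (p + 1) q M).length by rw [hlen]; omega)
    constructor
    · rcases hz with ⟨h1, f1, y1⟩ | ⟨j, hj, rfl, -⟩ | ⟨j, hj1, -, rfl, f1, y1⟩
      · rw [f1] at e1; omega
      · omega
      · rw [f1] at e1; omega
    · rcases hz' with ⟨h1, f1, y1⟩ | ⟨j, hj, hij, -⟩ | ⟨j, hj1, -, hij, f1, y1⟩
      · omega
      · omega
      · rw [f1] at e2; omega
  · rintro ⟨h1, h2⟩
    obtain ⟨j, rfl⟩ : ∃ j, i = p + 1 + j := ⟨i - (p + 1), by omega⟩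
    exact ⟨hy3 j (by omega), by rw [add_assoc]; exact hy3 (j + 1) (by omega)⟩

end BandSplice

end BandSpliceSec
/-! ### Gluing: the glued word is a 2-4-2 word, and the pieces can be read off it -/

section GlueSide

variable {k i jj t w m : ℕ} {W' Q : List (Fin 4)}

/-- **Gluing a building block under a 2-4-2 polygon gives a 2-4-2 polygon** with one more pair of
rows, the same bottom row, half-perimeter `i + j` from `i` and `j + t` (`t` the duplicated row:
"two horizontal bonds are removed for each cell in the join"); and the glued word remembers its
pieces (its band decomposition is at the same `p`, its body is the body of `W'`, `t = b - a`, and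
the block is recovered by splicing back `W^t`). [cite: Rechnitzer2006Haruspicy2, Lemma 23] -/
theorem glue_spec (hk : 1 ≤ k) (hW : W' ∈ c242Words k i t) (hQ : Q ∈ bbWords (jj + t) t w)
    (him : i + jj = m) :
    glue W' Q ∈ c242Words (k + 1) m w ∧
    ∃ p ℓ, IsBand (glue W' Q) w p (p + 1 + ℓ) ∧ ((glue W' Q).drop (p + 1)).take ℓ = body W' ∧
      W' = upperWord t (body W') ∧
      (t : ℤ) = vtx (glue W' Q) p 0 - vtx (glue W' Q) (p + 1 + ℓ + 1) 0 ∧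
      Q = splice (glue W' Q) (p + 1) (p + 1 + ℓ) (List.replicate t 1) := by
  obtain ⟨hU, heq, -, hmaxW, hrowsW, hnegW⟩ := upper_data hk hW
  obtain ⟨p, q, hb, hqt, hxpt, -, htake, hft, -, h0Q, h1Q, h2Q, hgeQ⟩ := block_data hQ
  rw [mem_c242Words] at hW
  obtain ⟨hlenW, -, hhcW, -, hbwW⟩ := hW
  rw [mem_bbWords] at hQ
  obtain ⟨hlenQ, hcanQ, hhcQ, -, -, -⟩ := hQ
  have hBS : BandSplice Q (body W') t w p q := ⟨hcanQ, hb, hxpt, hU⟩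
  have hG : glue W' Q = splice Q (p + 1) q (body W') := by rw [glue, hft, hbwW, hqt]
  rw [hG]
  have ht1 := hU.one_le
  have hq := hb.q_le
  have hmidQ : (Q.drop (p + 1)).take (q - (p + 1)) = List.replicate t 1 := by
    rw [show q - (p + 1) = t by omega]; exact htake
  have hXmid : UpperHyp t ((Q.drop (p + 1)).take (q - (p + 1))) := by
    rw [hmidQ]; exact upperHyp_replicate ht1
  have hlenW' : W'.length = t + 2 + (body W').length := by
    conv_lhs => rw [heq]
    exact length_upperWord t _
  have hhcW' : hcount W' = t + hcount (body W') := by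
    conv_lhs => rw [heq]
    exact hcount_upperWord t _
  refine ⟨?_, p, (body W').length, hBS.isBand, hBS.take_drop, heq, by have := hBS.x_p_splice; omega, ?_⟩
  · rw [mem_c242Words]
    refine ⟨?_, hBS.isCanon, ?_, ?_, hBS.bottomWidth_eq⟩
    · rw [hBS.length_eq]; omega
    · have := hcount_splice (X := Q) (M := body W') (show p + 1 ≤ q by omega)
      rw [hmidQ, hcount_replicate_one] at this
      omega
    · rw [hBS.isCanon.is242_iff]
      constructor
      · rw [hBS.yMax_eq, ← heq, hmaxW, Nat.cast_sub (by omega)]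
        push_cast
        ring
      · intro n hn
        have hrel := hBS.rowVerticalBonds_eq hXmid n
        rw [hmidQ, rowVerticalBonds_rect ht1, ← heq] at hrel
        rcases (show n = 0 ∨ n = 1 ∨ n = 2 ∨ 3 ≤ n by omega) with rfl | rfl | rfl | h3
        · have e2 := hnegW (-2) (by norm_num)
          norm_num at hrel ⊢
          rw [h0Q, e2] at hrel
          omega
        · have e2 := hnegW (-1) (by norm_num)
          norm_num at hrel ⊢
          rw [h1Q, e2] at hrel
          omega
        · have e2 : rowVerticalBonds (bonds W') 0 = 2 := by simpa using hrowsW 0 (by omega)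
          norm_num at hrel ⊢
          rw [h2Q, e2] at hrel
          omega
        · have hQ0 : rowVerticalBonds (bonds Q) n = 0 := hgeQ n (by exact_mod_cast h3)
          have hcast : (n : ℤ) - 2 = ((n - 2 : ℕ) : ℤ) := by omega
          have hW2 := hrowsW (n - 2) (by omega)
          have hpar : (Even (n - 2) ↔ Even n) := by
            rw [Nat.even_sub (by omega)]
            simp
          rw [if_neg (show ¬((n : ℤ) - 2 = 0) by omega), hcast, hW2, hQ0, zero_add, add_zero] at hrel
          rw [hrel]
          simp only [hpar]
  · have := hBS.splice_back
    rw [hmidQ] at this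
    exact this.symm

end GlueSide

/-! ### Cutting: every 2-4-2 word with at least three rows is glued from a unique pair -/

section CutSide

/-- The bookkeeping of lengths and letter counts in the cut. [folklore] -/
theorem cut_arith {N NQ NU m k p q T ℓ hQ hβ hW cU c0 c1 : ℕ} (hk : 1 ≤ k)
    (hN : N = 2 * (m + (3 * (k + 1) - 2))) (hq : q + 3 ≤ N) (hpq : p + 1 ≤ q)
    (hNQ : NQ = p + 1 + T + (N - q)) (hNU : NU = T + 2 + ℓ) (hℓ : ℓ = q - (p + 1))
    (hvc : NQ = hQ + 8) (hsplit : hQ + hβ = hW + T) (hhW : hW = 2 * m) (hhU : cU = T + hβ)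
    (hcU : cU = 2 * c0) (hcQ : hQ = 2 * c1) (hTQ : T ≤ c1) (hTU : T ≤ c0) :
    NU = 2 * (c0 + (3 * k - 2)) ∧ NQ = 2 * ((m - c0) + T + 4) ∧ hQ = 2 * ((m - c0) + T) ∧
      T ≤ m ∧ c0 ≤ m := by
  omega

variable {k m w : ℕ} {W : List (Fin 4)}

/-- **Cutting a 2-4-2 polygon along its duplicated third row** gives a 2-4-2 polygon with one
pair of rows less (above, bottom row `t = b - a`) and a building block (below, top row `t`) of
complementary half-perimeters, which glue back to it: the decomposition of Rechnitzer's Fig. 9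
read on canonical words. [cite: Rechnitzer2006Haruspicy2, Lemma 23] -/
theorem cut_spec (hk : 1 ≤ k) (hW : W ∈ c242Words (k + 1) m w) :
    ∃ t i jj : ℕ, ∃ W' Q : List (Fin 4), t ∈ Finset.Icc 1 m ∧ (i, jj) ∈ Finset.antidiagonal m ∧
      W' ∈ c242Words k i t ∧ Q ∈ bbWords (jj + t) t w ∧ glue W' Q = W := by
  rw [mem_c242Words] at hW
  obtain ⟨hlen, hcan, hhc, h242, hbw⟩ := hW
  rw [hcan.is242_iff] at h242
  obtain ⟨hmax, hrows⟩ := h242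
  have hk2 : ((2 * (k + 1) - 1 : ℕ) : ℤ) = 2 * k + 1 := by omega
  rw [hk2] at hmax
  have h0 : rowVerticalBonds (bonds W) 0 = 2 := by simpa using hrows 0 (by omega)
  have h1 : rowVerticalBonds (bonds W) 1 = 4 := by simpa using hrows 1 (by omega)
  have h2 : rowVerticalBonds (bonds W) 2 = 2 := by
    have := hrows 2 (by omega)
    norm_num at this
    exact this
  obtain ⟨p, q, hb⟩ := hcan.exists_isBand h0 h1.le h2
  rw [hbw] at hb
  have hq := hb.q_le
  have hpq := hb.p_lt_q
  have hwp := hb.le_p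
  -- the width `T = b - a` of the duplicated row and the body `β`
  obtain ⟨T, hT⟩ : ∃ T, (vtx W p 0 - vtx W (q + 1) 0).toNat = T := ⟨_, rfl⟩
  have hT1 : 1 ≤ T := hT ▸ hb.one_le_toNat
  have hxp : vtx W p 0 = vtx W (q + 1) 0 + T := hT ▸ hb.x_p_eq
  obtain ⟨β, hβ⟩ : ∃ β, (W.drop (p + 1)).take (q - (p + 1)) = β := ⟨_, rfl⟩
  have hℓ : β.length = q - (p + 1) := by rw [← hβ, List.length_take, List.length_drop]; omega
  have hvβ : ∀ j ≤ q - (p + 1), vtx β j = vtx W (p + 1 + j) - vtx W (p + 1) := fun j hj => by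
    rw [← hβ]; exact BandSplice.vtx_take_drop hj
  have hUβ : UpperHyp T β := by
    refine ⟨hT1, ?_, fun j hj => ?_, fun j j' hj hj' he => ?_⟩
    · rw [← vtx_length, hℓ, hvβ _ le_rfl, show p + 1 + (q - (p + 1)) = q by omega]
      ext i; fin_cases i
      · simp only [Fin.zero_eta, Fin.isValue, Pi.sub_apply, Matrix.cons_val_zero]
        rw [← hb.x_q1, hb.x_p1, hxp]; ring
      · simp only [Fin.mk_one, Fin.isValue, Pi.sub_apply, Matrix.cons_val_one, Matrix.cons_val_fin_one]
        rw [hb.y_q, hb.y_p1]; ring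
    · rw [hℓ] at hj
      rw [hvβ j hj, Pi.sub_apply, hb.y_p1]
      have := hb.top (p + 1 + j) (by omega) (by omega)
      omega
    · rw [hℓ] at hj hj'
      rw [hvβ j hj, hvβ j' hj', sub_left_inj] at he
      have := hcan.1.2.2 (show p + 1 + j ∈ Set.Iio W.length by simp; omega)
        (show p + 1 + j' ∈ Set.Iio W.length by simp; omega) he
      omega
  have hUβ' : UpperHyp T ((W.drop (p + 1)).take (q - (p + 1))) := by rw [hβ]; exact hUβ
  -- the cut-off building block `Q₀` and the upper polygon `W₀`
  have hBS : BandSplice W (List.replicate T 1) T w p q := ⟨hcan, hb, hxp, upperHyp_replicate hT1⟩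
  obtain ⟨Q₀, hQ₀⟩ : ∃ Q₀, splice W (p + 1) q (List.replicate T 1) = Q₀ := ⟨_, rfl⟩
  obtain ⟨W₀, hW₀⟩ : ∃ W₀, upperWord T β = W₀ := ⟨_, rfl⟩
  have hlenR : (List.replicate T (1 : Fin 4)).length = T := List.length_replicate
  have hcanQ : IsCanon Q₀ := hQ₀ ▸ hBS.isCanon
  have hlenQ : Q₀.length = p + 1 + T + (W.length - q) := by rw [← hQ₀, hBS.length_eq, hlenR]
  have hmaxQ : yMax (bonds Q₀) = 3 := by rw [← hQ₀, hBS.yMax_eq, yMax_rect hT1]; norm_num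
  have hbwQ : bottomWidth (bonds Q₀) = w := hQ₀ ▸ hBS.bottomWidth_eq
  have hftQ : firstTop Q₀ = p + 1 := hQ₀ ▸ hBS.firstTop_splice
  have hbandQ : IsBand Q₀ w p (p + 1 + T) := by have := hBS.isBand; rwa [hlenR, hQ₀] at this
  have htwQ : topWidth (bonds Q₀) = T := hQ₀ ▸ hBS.topWidth_eq_of_replicate rfl
  have hxpQ : vtx Q₀ p 0 = vtx Q₀ (p + 1 + T + 1) 0 + T := by
    have := hBS.x_p_splice; rwa [hlenR, hQ₀] at this
  have hback : splice Q₀ (p + 1) (p + 1 + T) β = W := by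
    have := hBS.splice_back; rwa [hlenR, hQ₀, hβ] at this
  have hrel : ∀ r : ℤ, rowVerticalBonds (bonds Q₀) r + rowVerticalBonds (bonds W₀) (r - 2) =
      rowVerticalBonds (bonds W) r + if r - 2 = 0 then 2 else 0 := fun r => by
    have := hBS.rowVerticalBonds_eq hUβ' r
    rwa [hQ₀, hβ, hW₀, rowVerticalBonds_rect hT1] at this
  have hcanU : IsCanon W₀ := hW₀ ▸ hUβ.isCanon
  have hbwU : bottomWidth (bonds W₀) = T := hW₀ ▸ hUβ.bottomWidth_eq
  have hbodyU : body W₀ = β := by rw [← hW₀]; exact hUβ.body_eq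
  have hlenU : W₀.length = T + 2 + β.length := hW₀ ▸ length_upperWord T β
  have hhcU : hcount W₀ = T + hcount β := hW₀ ▸ hcount_upperWord T β
  -- `yMax W₀ = 2k - 1`: `W` is glued from `W₀` and `Q₀`
  have hBS2 : BandSplice Q₀ β T w p (p + 1 + T) := ⟨hcanQ, hbandQ, hxpQ, hUβ⟩
  have hmaxU : yMax (bonds W₀) = 2 * k - 1 := by
    have := hBS2.yMax_eq
    rw [hback, hW₀, hmax] at this
    omega
  -- the vertical bonds of `Q₀` and `W₀`
  have hyQ : ∀ i ≤ Q₀.length, 0 ≤ vtx Q₀ i 1 ∧ vtx Q₀ i 1 ≤ (3 : ℕ) := fun i hi =>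
    ⟨hcanQ.2.1.vtx_one_nonneg' hcanQ.1.2.1 hi, by
      have := vtx_le_yMax hcanQ.1.2.1 hi; rw [hmaxQ] at this; exact_mod_cast this⟩
  have hnegU : ∀ r : ℤ, r < 0 → rowVerticalBonds (bonds W₀) r = 0 := fun r hr =>
    rowVerticalBonds_eq_zero_of_neg (fun i hi => hcanU.2.1.vtx_one_nonneg' hcanU.1.2.1 hi) hr
  have hgeQ : ∀ r : ℤ, 3 ≤ r → rowVerticalBonds (bonds Q₀) r = 0 := fun r hr =>
    rowVerticalBonds_eq_zero_of_ge 3 (fun i hi => by exact_mod_cast (hyQ i hi).2) hr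
  have hU0 : rowVerticalBonds (bonds W₀) 0 = 2 := by
    rw [← hW₀, hUβ.rowVerticalBonds_eq 0, if_pos rfl]
    have : ((Finset.range β.length).filter fun j =>
        IsCross 0 (1 + vtx β j 1) (1 + vtx β (j + 1) 1)).card = 0 := by
      rw [Finset.card_eq_zero, Finset.filter_eq_empty_iff]
      intro j hj
      rw [Finset.mem_range] at hj
      have := hUβ.nonneg j hj.le
      have := hUβ.nonneg (j + 1) hj
      rw [IsCross]; omega
    rw [this]
  have hQ0 : rowVerticalBonds (bonds Q₀) 0 = 2 := by
    have := hrel 0; rw [h0, hnegU _ (by norm_num)] at this; norm_num at this; exact this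
  have hQ1 : rowVerticalBonds (bonds Q₀) 1 = 4 := by
    have := hrel 1; rw [h1, hnegU _ (by norm_num)] at this; norm_num at this; exact this
  have hQ2 : rowVerticalBonds (bonds Q₀) 2 = 2 := by
    have := hrel 2; rw [h2] at this; norm_num at this; rw [hU0] at this; omega
  have hUn : ∀ n : ℕ, 1 ≤ n → n < 2 * k - 1 → rowVerticalBonds (bonds W₀) n = if Even n then 2 else 4 := by
    intro n hn1 hn2
    have := hrel (n + 2)
    rw [if_neg (by omega), hgeQ _ (by omega), show (n : ℤ) + 2 - 2 = n by ring,
      show (n : ℤ) + 2 = ((n + 2 : ℕ) : ℤ) by push_cast; ring, hrows (n + 2) (by omega),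
      zero_add, add_zero] at this
    rw [this]
    have hpar : (Even (n + 2) ↔ Even n) := by rw [Nat.even_add]; simp
    simp only [hpar]
  -- the letter counts
  have hcU : hcount W₀ = 2 * W₀.count 0 := hcount_eq_two_mul_count _ (hW₀ ▸ hUβ.sum_eq_zero)
  have hcQ : hcount Q₀ = 2 * Q₀.count 1 := hcount_eq_two_mul_count_one _ hcanQ.1.2.1
  have hTQ : T ≤ Q₀.count 1 := by
    rw [← hQ₀, splice]
    simp only [List.count_append, List.count_replicate_self]
    omega
  have hTU : T ≤ W₀.count 0 := by
    rw [← hW₀, upperWord]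
    simp only [List.count_append, List.count_replicate_self]
    omega
  have hsplit : hcount Q₀ + hcount β = hcount W + T := by
    have := hcount_splice (X := W) (M := List.replicate T 1) (show p + 1 ≤ q by omega)
    rwa [hQ₀, hβ, hcount_replicate_one] at this
  have hvc := length_eq_hcount_add_sum 3 hyQ
  rw [Finset.sum_range_succ, Finset.sum_range_succ, Finset.sum_range_succ, Finset.sum_range_zero] at hvc
  norm_num at hvc
  rw [hQ0, hQ1, hQ2] at hvc
  -- the half-perimeters `i` of `W₀` and `jj` of `Q₀` (less the join): bookkeeping
  obtain ⟨l1, l2, l3, l4, l5⟩ := cut_arith hk hlen (by omega) (by omega) hlenQ hlenU hℓ hvc hsplit hhc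
    hhcU hcU hcQ hTQ hTU
  refine ⟨T, W₀.count 0, m - W₀.count 0, W₀, Q₀, ?_, ?_, ?_, ?_, ?_⟩
  · rw [Finset.mem_Icc]; exact ⟨hT1, l4⟩
  · rw [Finset.mem_antidiagonal]; exact Nat.add_sub_cancel' l5
  · rw [mem_c242Words]
    refine ⟨l1, hcanU, hcU, ?_, hbwU⟩
    rw [hcanU.is242_iff]
    refine ⟨by rw [hmaxU, Nat.cast_sub (by omega)]; push_cast; ring, fun n hn => ?_⟩
    rcases Nat.eq_zero_or_pos n with rfl | hn1
    · simpa using hU0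
    · exact hUn n hn1 hn
  · rw [mem_bbWords]
    refine ⟨l2, hcanQ, l3, ?_, htwQ, hbwQ⟩
    rw [hcanQ.is242_iff]
    refine ⟨by rw [hmaxQ]; norm_num, fun n hn => ?_⟩
    rcases (show n = 0 ∨ n = 1 ∨ n = 2 by omega) with rfl | rfl | rfl
    · simpa using hQ0
    · simpa using hQ1
    · norm_num; exact hQ2
  · rw [glue, hftQ, hbwU, hbodyU, hback]

end CutSide

end Haruspicy

/-! ### Lemma 23 -/

open Haruspicy in
/-- **Rechnitzer 2006, Lemma 23, discharged**: in the rooted-walk model, the 2-4-2 polygons with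
`6(k+1)-4` vertical bonds, horizontal half-perimeter `m` and bottom row `w` are equinumerous with
the pairs (2-4-2 polygon with `6k-4` vertical bonds, half-perimeter `i`, bottom row `t`;
building block with half-perimeter `j + t`, top row `t`, bottom row `w`), `i + j = m`, `t ≥ 1`
— by cutting along / gluing along the duplicated row (Rechnitzer's Figures 9–10), on canonical
words (`glue_spec`, `cut_spec`) and the `2N`-to-one correspondence (`p242Count_eq_card_c242Words`,
`bbCount_eq_card_bbWords`). [cite: Rechnitzer2006Haruspicy2, Lemma 23, eq. (28)] -/
theorem Rechnitzer2006_lem23_holds : Rechnitzer2006_lem23 := by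
  intro k hk m w
  rw [p242Count_eq_card_c242Words]
  have hR : ∑ t ∈ Icc 1 m, ∑ ij ∈ antidiagonal m, p242Count k ij.1 t * bbCount (ij.2 + t) t w =
      ((Icc 1 m ×ˢ antidiagonal m).sigma fun x =>
        c242Words k x.2.1 x.1 ×ˢ bbWords (x.2.2 + x.1) x.1 w).card := by
    rw [Finset.card_sigma, Finset.sum_product]
    refine Finset.sum_congr rfl fun t _ => Finset.sum_congr rfl fun ij _ => ?_
    rw [Finset.card_product, p242Count_eq_card_c242Words, bbCount_eq_card_bbWords]
  rw [hR]
  symm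
  apply Finset.card_bij (fun a _ => glue a.2.1 a.2.2)
  · rintro ⟨⟨t, i, jj⟩, W', Q⟩ ha
    simp only [Finset.mem_sigma, Finset.mem_product, Finset.mem_Icc, Finset.mem_antidiagonal] at ha
    exact (glue_spec hk ha.2.1 ha.2.2 ha.1.2).1
  · rintro ⟨⟨t₁, i₁, j₁⟩, W₁, Q₁⟩ ha₁ ⟨⟨t₂, i₂, j₂⟩, W₂, Q₂⟩ ha₂ he
    simp only [Finset.mem_sigma, Finset.mem_product, Finset.mem_Icc, Finset.mem_antidiagonal] at ha₁ ha₂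
    dsimp only at he
    obtain ⟨-, p₁, ℓ₁, hb₁, hbody₁, heq₁, ht₁, hQe₁⟩ := glue_spec hk ha₁.2.1 ha₁.2.2 ha₁.1.2
    obtain ⟨-, p₂, ℓ₂, hb₂, hbody₂, heq₂, ht₂, hQe₂⟩ := glue_spec hk ha₂.2.1 ha₂.2.2 ha₂.1.2
    rw [he] at hb₁ hbody₁ ht₁ hQe₁
    obtain ⟨rfl, hq⟩ := hb₁.unique hb₂
    obtain rfl : ℓ₁ = ℓ₂ := by omega
    have hβ : body W₁ = body W₂ := by rw [← hbody₁, ← hbody₂]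
    obtain rfl : t₁ = t₂ := by have := ht₁.trans ht₂.symm; exact_mod_cast this
    obtain rfl : W₁ = W₂ := by rw [heq₁, heq₂, hβ]
    obtain rfl : Q₁ = Q₂ := hQe₁.trans hQe₂.symm
    have hi₁ := (mem_c242Words.1 ha₁.2.1).2.2.1
    have hi₂ := (mem_c242Words.1 ha₂.2.1).2.2.1
    obtain rfl : i₁ = i₂ := by omega
    obtain rfl : j₁ = j₂ := by omega
    rfl
  · intro W hW
    obtain ⟨t, i, jj, W', Q, ht, hij, hW', hQ, hglue⟩ := cut_spec hk hW
    exact ⟨⟨(t, i, jj), W', Q⟩, by simp [Finset.mem_sigma, ht, hij, hW', hQ], hglue⟩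

end Literature.Barriers.CriticalPhenomena
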